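import Summits.HubbardSuperconductivity.HubbardSuperconductivity.Theses.BalabanIR
import Summits.HubbardSuperconductivity.HubbardSuperconductivity.Theorems.BalabanIRBirGroundStateAverageLRO
import Literature.MathematicalPhysics.QuantumLattice.HubbardGaugeBound
import Literature.MathematicalPhysics.QuantumLattice.TraceInequalitiesProofs

/-!
# Disproof of `BirGappedPhaseReduction` — findings (cdisprove, cycle 1, 2026-08-15)

Crux `stmt-HubbardSuperconductivity-2082` of route BalabanIR, typed as the bare implication
`BirGappedPhaseReduction := BirComplexStableXY → BirGroundStateAverageLRO`
(engine ⇒ ground-state-average d-wave pair LRO on an open weak-coupling window).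

## Headline: the crux is unfalsifiable in isolation (§1)

`not_reduction_iff` : `¬ BirGappedPhaseReduction ↔ BirComplexStableXY ∧ ¬ BirGroundStateAverageLRO`.
A disproof must therefore (i) PROVE the engine (crux 2, stmt-2080) exactly as typed AND
(ii) REFUTE the target (stmt-2079). Both are out of reach, for opposite reasons:

* (i) the engine AS TYPED is on record as SUSPECT-FALSE (refuter 702958a1 on stmt-2080, evidence
  `Crux2_TransferZeros.md`, `crux2_chain_scripts_and_outputs.txt`, `Crux2_Addendum_Dressing.md`):
  for the admissible table `F = (c₀+iε₁)·Σ_{w,w'}(1−cos(φ_w−φ_{w'})) + iε₂·sin(φ_{(0,0,1)}−φ_{(0,0,0)})`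
  the slice transfer operator has an equimodular top rotor doublet when `Kε₂L²` is near a
  half-integer, and `Z_M = Tr T^M` has exact transversal zeros at `M ∝ K²L⁴`
  (Beraha–Kahane–Weiss accumulation; Newton-certified zeros of the reduced k_s = 0 chain at
  κ = 30/100/300, M = 5515/64029/583437). If that is ever made a Lean theorem
  `¬ BirComplexStableXY`, THIS crux closes `proved` by `reduction_of_not_engine` — for the wrong
  reason (vacuity warning for the planner: re-type 2082 against the restated engine, §4).
* (ii) `¬ BirGroundStateAverageLRO` says: for EVERY δ ∈ (0,1/2) and a DENSE set of couplings
  U > 0 (every open window), liminf_L (GS-average ⟨Δ_d†Δ_d⟩)/L⁴ = 0 along even L — absence of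
  ground-state d-wave pairing order in the pure 2D Hubbard model at all dopings and (densely) all
  couplings. No theorem in print or in the tree comes close: the catalogued negatives are T > 0
  only (`Literature.Barriers.HubbardSuperconductivity.PositiveTemperatureNoPairLRO`,
  `…HohenbergMerminWagnerPairing`: Koma–Tasaki 1992), mean-field only
  (`…GeneralizedHartreeFockNoPairing`: BLS 1994 Thm 2.11), numerical and local in (U,δ)
  (`…PureModelStripeCompetition`: Qin et al. 2020 at U = 8, δ = 1/8), or constrain the spectrum
  without forbidding order (`…LROForcesLowLyingStates`). Yang's bound λ_max(ρ₂) ≤ O(N) only caps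
  ⟨Δ_d†Δ_d⟩ at O(L⁴), the order the target asks for (c is existential), so it does not bite.
  `ledger negatives --problem HubbardSuperconductivity`: 1 entry (AposterioriCapRg KLS openness),
  unrelated.

So: `BirGappedPhaseReduction` RESISTS DISPROOF STRUCTURALLY. It is glue: implied by the target
alone (`reduction_of_target`) and by ¬engine (`reduction_of_not_engine`); given the engine it is
truth-equivalent to the target (`reduction_iff_target`).

## §2 Load-bearing analysis

The crux has ONE hypothesis, the engine. `BirGappedPhaseReductionWithoutEngine` is literally the
target (`withoutEngine_iff_target`), an open problem: no `_false_without_` theorem is available,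
and none is expected (it would settle the summit negatively on a dense set of U).

## §3 What the reduction must deliver: degenerate corners of the engine class are FALSE claims

The reduction's informal content is "the fermion-induced phase action lands INSIDE the class of
crux 2". Three side conditions of that class are each NECESSARY — dropping any one admits the
ZERO TABLE c = 0 (action A ≡ 0, uniform measure), for which Z = (2π)^{|Λ|} ≠ 0 but the slice
order is exactly 1/L² < 1/2 (`sliceOrder_zero_action_re`, a sorry-free computation: Fubini on
the cube + ∫₀^{2π} e^{it} dt = 0):
* `birComplexStableXY_false_without_coercivity` : ¬ (engine with hypothesis (C) deleted);
* `birComplexStableXY_false_with_c₀_nonneg`     : ¬ (engine with `0 < c₀` weakened to `0 ≤ c₀`);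
* `birComplexStableXY_false_without_window_lb`  : ¬ (engine with `2 ≤ r` deleted; witness r = 1,
  where (U1)+(N) force F ≡ 0 on a one-point window and (C) is void).
Moral for 2082: the induced table must be GENUINELY coercive with c₀ > 0 bounded below uniformly
on the U-window (c₀ ~ min(ρ_s, Δ²) in units of K — crux 3's job for spatial gradients; temporal
gradients have NO coercivity source in a compressible-phase action, only Gaussian/Berry control —
the planner's own caveat (iii)), and (U1),(N),(A) do not substitute for it.

## §3b Tightness of the conclusion the reduction must produce (target side)

`constant_le_of_trace_bound`: at ANY `(t, U, δ ≥ -1, L ≥ 1)`, the target's trace bound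
`c·L⁴·Re tr P ≤ Re tr (P Δ_d†Δ_d)` forces `c ≤ 100` (‖Δ_d‖ ≤ 10L² by ‖c_xσ‖ ≤ 1 and the triangle
inequality; `|tr(O P)| ≤ ‖O‖ Re tr P` for the PSD projection P; `Re tr P ≥ 1`, the prover's
non-vacuity lemma). Hence `not_target_with_constant_gt_100`: the natural strengthening of
X_avg with c > 100 is FALSE — the exponent 4 is saturated, the target is sandwiched
(non-vacuous below, capped above), and the reduction's step (4) constant c = Z|ψ_B1g|²/4 must come
out ≤ 100 (consistent: Z ≤ 1, |ψ| ≤ O(1)). No refutation of the target itself follows.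

## §3c The admissible class is INHABITED (the engine is not vacuously true)

`engine_class_inhabited`: for every r and c₀ ≥ 0 the real XY window table
`c = Σ_{(w,w')} c₀ • (δ_0 − δ_{e_w − e_{w'}})` (F(φ) = c₀ Σ_{w,w'} (1 − e^{i(φ_w − φ_{w'})})) satisfies
(U1), (N), (A) with B = c₀ r⁶ (1 + e²), and (C) with EQUALITY (`xyTable_C`). So for B ≥ c₀r⁶(1+e²)
the engine's ∀c is not over an empty class: `BirComplexStableXY` has content, hence
`BirGappedPhaseReduction` is NOT automatically equivalent to the target by emptiness of the class,
and the K → ∞ caricature of the reduction's BdG phase stiffness (real, nearest-window XY) is a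
legitimate member — the real case the support item BirSliceXYOrderRP calibrates.

## §4 Restated engines and the sandwich (what provers of the honest reduction get for free)

The repair proposed on stmt-2080 is to SHRINK the admissible class by time-reflection
Hermiticity of the table, `c (n ∘ R) = conj (c n)` (R = temporal reflection of the window; holds
for any fermion-induced action by OS positivity of Tr e^{−βH}). `BirComplexStableXYTimeReflective`
types it; `engine_imp_timeReflective` (bigger class ⇒ smaller class) and hence
`reduction_of_timeReflectiveReduction : (BirComplexStableXYTimeReflective → target) → BirGappedPhaseReduction`.
So 2082 AS TYPED is implied by the honest (restated) reduction: it need not be re-typed for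
SOUNDNESS, only to remove the vacuous proof of §1(i). Conversely a restated engine that CAPS
M ≤ M₀(K,L) (the other repair) would break step (3) of the informal reduction (β → ∞ at fixed L
is M → ∞ at fixed L) — recorded here as the one restatement the reduction cannot absorb.
WHY THE TIME-REFLECTIVE CLASS PLAUSIBLY ESCAPES THE stmt-2080 ZEROS (informal + numerics, this
session): for a time-reflective table the k_s = 0 (slice-constant) chain has transfer kernel
`T(Δ) = exp(−κ(1 − cos Δ) − iλ sin Δ)`, κ = 32c₀KL², λ = ε₂KL² (r = 2), with `T(−Δ) = conj T(Δ)`: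
a HERMITIAN convolution operator with REAL eigenvalues t_m = e^{−κ}(a/b)^{m/2} I_m(2√(ab)),
a = (κ−λ)/2, b = (κ+λ)/2. (i) s := λ/κ = ε₂/(32c₀) ≤ 1: every t_m > 0 (Bessel-I positivity) — the
chain transfer operator is POSITIVE, Z_M = Σ t_m^M > 0 for all M, no zeros; this is a TABLE
condition, independent of K. (ii) s > 1: t_{−n} = e^{−κ}(b/|a|)^{n/2} J_n(√(λ²−κ²)) IS negative for
some n < √(λ²−κ²) — Hermiticity gives no sign-definiteness — but the negative eigenvalues are
subdominant by a factor decaying in κ/s²: pure-python quadrature (this folder, local_chain_check*.py)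
gives max|t_neg|/t_top = 0.149, 0.091, 0.041, 0.014, 0.0026 at s = 3, κ = 5, 10, 20, 40, 80 and
0.304, 0.220, 0.149, 0.090, 0.043 at s = 6 (same values at 4κ: a function of κ/s², ≈ 0.2e^{−0.5κ/s²});
the positivity margin μ_M := Z_M/Σ|t_m|^M stays ≥ 0.998 for M = 9 at κ = 10, s ≤ 25, and even in
the extreme corner s = 50, 100 with κ = 3, 5, 10 (λ up to 1000; 150–520 significant negative
eigenvalues against 190–580 positive ones) max|t_neg|/t_top saturates at 0.59–0.70 (the Airy limit
of the kernel's spectrum: |Ai(first minimum)|/Ai(max) ≈ 0.78 is the heuristic ceiling) and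
μ_5 ≥ 0.81, μ_7 ≥ 0.91, μ_9 ≥ 0.957, μ_17 ≥ 0.9976, μ_33 ≥ 0.99999 — NO sign change of Z_M, hence no
zero of the time-reflective chain, anywhere scanned (local_chain_check3.py; the two queued farm jobs
j005295/j005963 were cancelled after 6 h in the queue, superseded by these local scans). Since
s ≤ B/(32e²c₀) on the class and κ ≥ 32c₀K₀L₀², the residual sign structure is in any case harmless
once K₀L₀² ≫ s_max²/c₀ — a genuine 'K ≥ K₀(B/c₀)' effect (the stmt-2080 note's reason 'eigenvalues
real and positive' holds only for s ≤ 1). In the Villain approximation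
Z_chain(M) = Σ_w e^{−2πiλw} e^{−2π²κw²/M} = ϑ₃(πλ | 2πiκ/M) > 0 for EVERY real λ (Jacobi triple
product): the half-integer-λ modulus ties of the stmt-2080 mechanism survive but carry no relative
phase — that phase came from the time-even ε₁. Not a proof (the full transfer operator is not
controlled), but it supports re-typing 2082 against `BirComplexStableXYTimeReflective`; a
reflection-POSITIVE restatement (s ≤ 1-type domination of the odd imaginary part by the coercive
part) would make the zero-mode positivity structural rather than asymptotic.

## §4b The stmt-2080 counterexample table versus the restated class (Lean, r = 2)

Sub-namespace `TimeReflection`: `table2080 c₀ ε₁ ε₂ = (c₀ + iε₁)·XY-window + Berry(ε₂)` —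
the table of the suspect-false analysis on stmt-2080 — is ADMISSIBLE in the typed class
(`table2080_admissible`: (U1), (N), (A) with budget B_T = ‖c₀+iε₁‖·64·(1+e²) + |ε₂|e², and (C)
with equality), is NOT time-reflective when ε₁ ≠ 0 (`table2080_not_timeReflective`, test
configuration φ₀ = π·[w₁ = 1], R-invariant, F_XY(φ₀) = 64κ), while its Berry part IS
(`berry_timeReflective`). This certifies, at the level of the typed hypotheses, both halves of
the re-typing advice: the counterexample lives in the class 2082 currently quantifies over, and the
time-reflective restatement of §4 removes it without removing the physical Berry term.

## §5 Informal content — attacks tried, why each fails to bite (details in NOTES.md)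
* WeakCouplingCeiling (barrier, conceded by the planner): bites the PROOF, not the statement.
* Chiral d+id window at t'=0, δ<1/2: RaghuKivelsonScalapino2010 Fig. 2 puts the B1g/B2g crossing
  near n ≈ 0.6 (δ ≈ 0.4 < 1/2); width of the coexistence sliver ~U² in δ at fixed U, so for δ*
  near δ_c(0) an open U-window inside it exists — consistent with the ∃δ ∃(U₁,U₂) shape. No kill.
* Berry term i·n̄·∇_τθ of the induced action: odd under time reflection, hence INSIDE the
  time-reflective class; it is the ε₂-term of the stmt-2080 analysis and alone does not create
  equimodular rotor doublets for K ≥ K₀(B/c₀) (702958a1). No kill of the restated line.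
* Small-model numerics (L = 4 ED of the target functional) cannot touch an eventually-in-L claim;
  deferred to cycle 2 as calibration only.

## Targets (lead's stuck stubs): none supplied (payload.stuck_stubs = []).
## Near-misses (sorried): none.
-/

namespace Summit.HubbardSuperconductivity.HubbardSuperconductivity.Cruxes.BirGappedPhaseReduction.Disproof

open MeasureTheory Complex Set
open scoped ComplexConjugate
open Summit.HubbardSuperconductivity.HubbardSuperconductivity.Theses.BalabanIR

/-! ## §1 Structure: what a disproof of the crux would have to contain -/

/-- The crux is implied by the target alone (it is weaker than what the route must prove anyway). -/
theorem reduction_of_target : BirGroundStateAverageLRO → BirGappedPhaseReduction :=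
  fun h _ => h

/-- The crux is implied by the failure of the engine: if `¬ BirComplexStableXY` is ever landed
(stmt-2080 is suspect-false as typed), stmt-2082 closes `proved` by this term — vacuously. -/
theorem reduction_of_not_engine : ¬ BirComplexStableXY → BirGappedPhaseReduction :=
  fun h e => absurd e h

/-- HEADLINE. Refuting the crux is EQUIVALENT to proving the engine as typed and refuting the
target. -/
theorem not_reduction_iff :
    ¬ BirGappedPhaseReduction ↔ (BirComplexStableXY ∧ ¬ BirGroundStateAverageLRO) := by
  unfold BirGappedPhaseReduction
  exact Classical.not_imp

/-- Given the engine, the crux is truth-equivalent to the target (the open problem X_avg). -/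
theorem reduction_iff_target (hE : BirComplexStableXY) :
    BirGappedPhaseReduction ↔ BirGroundStateAverageLRO :=
  ⟨fun h => h hE, fun h _ => h⟩

/-- The crux together with the engine is exactly as strong as the target together with the engine:
nothing is lost or gained by the implication typing once crux 2 is settled positively. -/
theorem reduction_and_engine_iff :
    (BirGappedPhaseReduction ∧ BirComplexStableXY) ↔ (BirGroundStateAverageLRO ∧ BirComplexStableXY) :=
  ⟨fun ⟨h, e⟩ => ⟨h e, e⟩, fun ⟨h, e⟩ => ⟨fun _ => h, e⟩⟩

/-! ## §2 Load-bearing analysis: the single hypothesis -/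

/-- The crux with its (only) hypothesis, the engine, dropped: this is the target itself. -/
def BirGappedPhaseReductionWithoutEngine : Prop := BirGroundStateAverageLRO

/-- `BirGappedPhaseReductionWithoutEngine` is the target, word for word (open problem; no
`_false_without_` theorem is available — see the module docstring, §1(ii)). -/
theorem withoutEngine_iff_target : BirGappedPhaseReductionWithoutEngine ↔ BirGroundStateAverageLRO :=
  Iff.rfl

/-! ## §3 Degenerate corners of the engine class: the zero-action computation -/


/-- `∫_{[0,2π]} e^{it} dt = 0`. -/
theorem setIntegral_Icc_cexp_I_mul :
    ∫ t in Icc (0:ℝ) (2 * Real.pi), cexp (I * (t : ℂ)) = 0 := by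
  rw [integral_Icc_eq_integral_Ioc, ← intervalIntegral.integral_of_le (by positivity),
    integral_exp_mul_complex I_ne_zero]
  have h2 : cexp (I * (2 * (Real.pi : ℂ))) = 1 := by
    rw [show I * (2 * (Real.pi : ℂ)) = 2 * Real.pi * I by ring]
    exact exp_two_pi_mul_I
  push_cast
  simp [h2]

/-- `∫_{[0,2π]} 1 dt = 2π` (complex-valued). -/
theorem setIntegral_Icc_one :
    ∫ _t in Icc (0:ℝ) (2 * Real.pi), (1 : ℂ) = ((2 * Real.pi : ℝ) : ℂ) := by
  rw [setIntegral_const, Real.volume_real_Icc_of_le (by positivity), sub_zero, Complex.real_smul, mul_one]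

/-- The basic orthogonality integral on the cube `[0,2π]^Λ`:
`∫ e^{iθ_a} e^{-iθ_b} dθ = [a = b] (2π)^{|Λ|}`. -/
theorem integral_cube_cexp_mul_cexp_neg {Λ : Type*} [Fintype Λ] [DecidableEq Λ] (a b : Λ) :
    ∫ θ in Set.pi Set.univ (fun _ : Λ => Icc (0:ℝ) (2 * Real.pi)),
      cexp (I * (θ a : ℂ)) * cexp (-(I * (θ b : ℂ))) =
    if a = b then (((2 * Real.pi) ^ Fintype.card Λ : ℝ) : ℂ) else 0 := by
  rw [volume_pi, Measure.restrict_pi_pi]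
  set f : Λ → ℝ → ℂ := fun i t =>
    (if i = a then cexp (I * (t : ℂ)) else 1) * (if i = b then cexp (-(I * (t : ℂ))) else 1) with hf
  have hprod : ∀ θ : Λ → ℝ, (∏ i, f i (θ i)) = cexp (I * (θ a : ℂ)) * cexp (-(I * (θ b : ℂ))) := by
    intro θ
    simp only [hf, Finset.prod_mul_distrib, Finset.prod_ite_eq', Finset.mem_univ, if_true]
  simp_rw [← hprod]
  rw [integral_fintype_prod_eq_prod]
  by_cases hab : a = b
  · subst hab
    have hfi : ∀ i, (∫ t in Icc (0:ℝ) (2 * Real.pi), f i t) = ((2 * Real.pi : ℝ) : ℂ) := by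
      intro i
      by_cases hi : i = a
      · subst hi
        have : ∀ t : ℝ, f i t = 1 := fun t => by
          simp only [hf, if_true, ← Complex.exp_add, add_neg_cancel, Complex.exp_zero]
        simp_rw [this]; exact setIntegral_Icc_one
      · have : ∀ t : ℝ, f i t = 1 := fun t => by simp [hf, hi]
        simp_rw [this]; exact setIntegral_Icc_one
    simp_rw [hfi]
    simp [Finset.prod_const, Finset.card_univ]
  · rw [if_neg hab]
    apply Finset.prod_eq_zero (Finset.mem_univ a)
    have : ∀ t : ℝ, f a t = cexp (I * (t : ℂ)) := fun t => by simp [hf, hab]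
    simp_rw [this]
    exact setIntegral_Icc_cexp_I_mul

/-- `|z|²` as `z · conj z` for a finite exponential sum. -/
theorem normSq_sum_cexp {σ : Type*} [Fintype σ] (θ : σ → ℝ) :
    (((‖∑ x, cexp (I * (θ x : ℂ))‖ ^ 2 : ℝ)) : ℂ) =
      ∑ x, ∑ y, cexp (I * (θ x : ℂ)) * cexp (-(I * (θ y : ℂ))) := by
  rw [← Complex.normSq_eq_norm_sq, ← Complex.mul_conj, map_sum, Finset.sum_mul_sum]
  refine Finset.sum_congr rfl fun x _ => Finset.sum_congr rfl fun y _ => ?_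
  congr 1
  rw [← Complex.exp_conj, map_mul, Complex.conj_I, Complex.conj_ofReal, neg_mul]


/-- Volume of the cube `[0,2π]^Λ` as a complex set integral of `1`. -/
theorem integral_cube_one {Λ : Type*} [Fintype Λ] :
    ∫ _θ in Set.pi Set.univ (fun _ : Λ => Icc (0:ℝ) (2 * Real.pi)), (1 : ℂ) =
      (((2 * Real.pi) ^ Fintype.card Λ : ℝ) : ℂ) := by
  rw [setIntegral_const, Measure.real_def, volume_pi_pi]
  simp only [Real.volume_Icc, sub_zero, Finset.prod_const, Finset.card_univ]
  rw [ENNReal.toReal_pow, ENNReal.toReal_ofReal (by positivity), Complex.real_smul, mul_one]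

/-- Integrability on the cube of the elementary oscillating products. -/
theorem integrable_cube_cexp_mul_cexp_neg {Λ : Type*} [Fintype Λ] (a b : Λ) :
    Integrable (fun θ : Λ → ℝ => cexp (I * (θ a : ℂ)) * cexp (-(I * (θ b : ℂ))))
      (volume.restrict (Set.pi Set.univ (fun _ : Λ => Icc (0:ℝ) (2 * Real.pi)))) := by
  have hc : Continuous (fun θ : Λ → ℝ => cexp (I * (θ a : ℂ)) * cexp (-(I * (θ b : ℂ)))) := by
    fun_prop
  exact hc.continuousOn.integrableOn_compact (isCompact_univ_pi fun _ => isCompact_Icc)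

/-- THE ZERO-ACTION SLICE INTEGRAL: for an injective slice map `e : σ → Λ`,
`∫_{[0,2π]^Λ} |Σ_{x∈σ} e^{iθ(e x)}|² / D dθ = |σ|·(2π)^{|Λ|} / D`. -/
theorem integral_cube_normSq_slice {Λ σ : Type*} [Fintype Λ] [DecidableEq Λ] [Fintype σ]
    [DecidableEq σ] (e : σ → Λ) (he : Function.Injective e) (D : ℝ) :
    ∫ θ in Set.pi Set.univ (fun _ : Λ => Icc (0:ℝ) (2 * Real.pi)),
      (((‖∑ x, cexp (I * (θ (e x) : ℂ))‖ ^ 2 / D : ℝ)) : ℂ) =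
    ((Fintype.card σ : ℝ) * (2 * Real.pi) ^ Fintype.card Λ / D : ℝ) := by
  have h1 : ∀ θ : Λ → ℝ, (((‖∑ x, cexp (I * (θ (e x) : ℂ))‖ ^ 2 / D : ℝ)) : ℂ) =
      (∑ x, ∑ y, cexp (I * (θ (e x) : ℂ)) * cexp (-(I * (θ (e y) : ℂ)))) / (D : ℂ) := by
    intro θ
    rw [Complex.ofReal_div, normSq_sum_cexp (fun x => θ (e x))]
  simp_rw [h1]
  rw [integral_div, integral_finsetSum _ (fun x _ => integrable_finsetSum _
        (fun y _ => integrable_cube_cexp_mul_cexp_neg (e x) (e y)))]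
  simp_rw [integral_finsetSum _ (fun y _ => integrable_cube_cexp_mul_cexp_neg (e _) (e y)),
    integral_cube_cexp_mul_cexp_neg, he.eq_iff, Finset.sum_ite_eq, Finset.mem_univ, if_true,
    Finset.sum_const, Finset.card_univ, nsmul_eq_mul]
  push_cast; ring

/-- At zero action the slice order is `1/L² < 1/2` (`L ≥ 2`): the ratio appearing in
`BirComplexStableXY` with `A ≡ 0`. -/
theorem sliceOrder_zero_action_re {L M : ℕ} [NeZero L] [NeZero M] (hL : 2 ≤ L) :
    ((∫ θ in Set.pi Set.univ (fun _ : (Literature.Probability.LatticeModels.TorusSite 2 L × ZMod M) => Icc (0:ℝ) (2 * Real.pi)),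
        (((‖∑ x : Literature.Probability.LatticeModels.TorusSite 2 L, cexp (I * (θ (x, 0) : ℂ))‖ ^ 2 / (L : ℝ) ^ 4 : ℝ)) : ℂ)) /
      ∫ _θ in Set.pi Set.univ (fun _ : (Literature.Probability.LatticeModels.TorusSite 2 L × ZMod M) => Icc (0:ℝ) (2 * Real.pi)), (1 : ℂ)).re
      < 1 / 2 := by
  rw [integral_cube_normSq_slice (fun x : Literature.Probability.LatticeModels.TorusSite 2 L => ((x, (0 : ZMod M)) : Literature.Probability.LatticeModels.TorusSite 2 L × ZMod M))
      (fun x y hxy => (Prod.mk.inj hxy).1) ((L : ℝ) ^ 4), integral_cube_one, ← Complex.ofReal_div,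
    Complex.ofReal_re]
  have hcard : (Fintype.card (Literature.Probability.LatticeModels.TorusSite 2 L) : ℝ) = (L : ℝ) ^ 2 := by
    rw [Fintype.card_pi, Finset.prod_const, ZMod.card, Finset.card_univ, Fintype.card_fin]; push_cast; ring
  rw [hcard]
  have hL' : (2 : ℝ) ≤ L := by exact_mod_cast hL
  set Q : ℝ := (2 * Real.pi) ^ Fintype.card (Literature.Probability.LatticeModels.TorusSite 2 L × ZMod M) with hQdef
  have hQ : (0 : ℝ) < Q := by positivity
  have hL2 : (4 : ℝ) ≤ (L : ℝ) ^ 2 := by nlinarith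
  have hL2Q : (0 : ℝ) < (L : ℝ) ^ 2 * Q := by positivity
  have h3 : (L : ℝ) ^ 2 * Q * 4 ≤ (L : ℝ) ^ 2 * Q * (L : ℝ) ^ 2 :=
    mul_le_mul_of_nonneg_left hL2 hL2Q.le
  rw [div_div, div_lt_iff₀ (by positivity)]
  calc (L : ℝ) ^ 2 * Q < (L : ℝ) ^ 2 * Q * 4 / 2 := by linarith
    _ ≤ (L : ℝ) ^ 2 * Q * (L : ℝ) ^ 2 / 2 := by linarith
    _ = 1 / 2 * ((L : ℝ) ^ 4 * Q) := by ring


/-- The engine `BirComplexStableXY` with the coercivity hypothesis (C) DELETED (all other text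
verbatim). -/
def BirComplexStableXYWithoutCoercivity : Prop :=
  ∀ (r : ℕ) (B c₀ : ℝ), 2 ≤ r → 0 < c₀ → ∃ K₀ : ℝ, ∃ L₀ : ℕ, ∀ K : ℝ, K₀ ≤ K → ∀ c : ((Fin r × Fin r × Fin r) → ℤ) →₀ ℂ, (∀ n ∈ c.support, ∑ w, n w = 0) → c.sum (fun _ a => a) = 0 → c.sum (fun n a => ‖a‖ * Real.exp (∑ w, |(n w : ℝ)|)) ≤ B → ∀ (L M : ℕ) [NeZero L] [NeZero M], L₀ ≤ L → L ≤ M → let sh : (Literature.Probability.LatticeModels.TorusSite 2 L × ZMod M) → (Fin r × Fin r × Fin r) → (Literature.Probability.LatticeModels.TorusSite 2 L × ZMod M) := fun s w => (s.1 + ![((w.1 : ℕ) : ZMod L), ((w.2.1 : ℕ) : ZMod L)], s.2 + ((w.2.2 : ℕ) : ZMod M)); let F : ((Fin r × Fin r × Fin r) → ℝ) → ℂ := fun (φ : (Fin r × Fin r × Fin r) → ℝ) => c.sum (fun n a => a * Complex.exp (Complex.I * ((∑ w, (n w : ℝ) * φ w : ℝ) : ℂ))); let A : ((Literature.Probability.LatticeModels.TorusSite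 2 L × ZMod M) → ℝ) → ℂ := fun θ => (K : ℂ) * ∑ s : (Literature.Probability.LatticeModels.TorusSite 2 L × ZMod M), F (fun w => θ (sh s w)); let cube : Set ((Literature.Probability.LatticeModels.TorusSite 2 L × ZMod M) → ℝ) := Set.pi Set.univ (fun _ => Set.Icc (0:ℝ) (2 * Real.pi)); let Z : ℂ := MeasureTheory.integral (MeasureTheory.volume.restrict cube) (fun θ => Complex.exp (-(A θ))); let O : ((Literature.Probability.LatticeModels.TorusSite 2 L × ZMod M) → ℝ) → ℝ := fun θ => ‖∑ x : Literature.Probability.LatticeModels.TorusSite 2 L, Complex.exp (Complex.I * (θ (x, 0) : ℂ))‖ ^ 2 / (L : ℝ) ^ 4; Z ≠ 0 ∧ (1/2 : ℝ) ≤ ((MeasureTheory.integral (MeasureTheory.volume.restrict cube) (fun θ => (O θ : ℂ) * Complex.exp (-(A θ)))) / Z).re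

/-- (C) is load-bearing: without coercivity the zero table `c = 0` is admissible ((U1), (N), (A)
hold trivially), the action vanishes, and the slice order is `1/L² < 1/2` for every `K`.
Any table the reduction (stmt-2082) feeds to the engine must therefore be genuinely coercive. -/
theorem birComplexStableXY_false_without_coercivity : ¬ BirComplexStableXYWithoutCoercivity := by
  intro h
  obtain ⟨K₀, L₀, h⟩ := h 2 0 1 le_rfl one_pos
  set L : ℕ := max L₀ 2 with hLdef
  haveI : NeZero L := ⟨by omega⟩
  have hL : L₀ ≤ L := le_max_left _ _
  have h2 : 2 ≤ L := le_max_right _ _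
  obtain ⟨_, hO⟩ := h K₀ le_rfl 0 (by simp) (by simp) (by simp) L L hL le_rfl
  simp only [Finsupp.sum_zero_index, Finset.sum_const_zero, mul_zero, neg_zero, Complex.exp_zero,
    mul_one] at hO
  exact absurd hO (not_le.mpr (sliceOrder_zero_action_re h2))

/-- The engine `BirComplexStableXY` with `0 < c₀` WEAKENED to `0 ≤ c₀` (all other text verbatim). -/
def BirComplexStableXYWithC₀Nonneg : Prop :=
  ∀ (r : ℕ) (B c₀ : ℝ), 2 ≤ r → 0 ≤ c₀ → ∃ K₀ : ℝ, ∃ L₀ : ℕ, ∀ K : ℝ, K₀ ≤ K → ∀ c : ((Fin r × Fin r × Fin r) → ℤ) →₀ ℂ, (∀ n ∈ c.support, ∑ w, n w = 0) → c.sum (fun _ a => a) = 0 → c.sum (fun n a => ‖a‖ * Real.exp (∑ w, |(n w : ℝ)|)) ≤ B → (∀ φ : (Fin r × Fin r × Fin r) → ℝ, c₀ * ∑ w, ∑ w', (1 - Real.cos (φ w - φ w')) ≤ ((fun (φ : (Fin r × Fin r × Fin r) → ℝ) => c.sum (fun n a => a * Complex.exp (Complex.I * ((∑ w, (n w : ℝ)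 * φ w : ℝ) : ℂ)))) φ).re) → ∀ (L M : ℕ) [NeZero L] [NeZero M], L₀ ≤ L → L ≤ M → let sh : (Literature.Probability.LatticeModels.TorusSite 2 L × ZMod M) → (Fin r × Fin r × Fin r) → (Literature.Probability.LatticeModels.TorusSite 2 L × ZMod M) := fun s w => (s.1 + ![((w.1 : ℕ) : ZMod L), ((w.2.1 : ℕ) : ZMod L)], s.2 + ((w.2.2 : ℕ) : ZMod M)); let F : ((Fin r × Fin r × Fin r) → ℝ) → ℂ := fun (φ : (Fin r × Fin r × Fin r) → ℝ) => c.sum (fun n a => a * Complex.exp (Complex.I * ((∑ w, (n w : ℝ) * φ w : ℝ) : ℂ))); let A : ((Literature.Probability.LatticeModels.TorusSite 2 L × ZMod M) → ℝ) → ℂ := fun θ => (K : ℂ) * ∑ s : (Literature.Probability.LatticeModels.TorusSite 2 L × ZMod M), F (fun w => θ (sh s w)); let cube : Set ((Literature.Probability.LatticeModels.TorusSite 2 L × ZMod M) → ℝ) := Set.pi Set.univ (fun _ => Set.Icc (0:ℝ) (2 * Real.pi)); let Z : ℂ := MeasureTheory.integral (MeasureTheory.volume.restrict cube) (fun θ =>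 Complex.exp (-(A θ))); let O : ((Literature.Probability.LatticeModels.TorusSite 2 L × ZMod M) → ℝ) → ℝ := fun θ => ‖∑ x : Literature.Probability.LatticeModels.TorusSite 2 L, Complex.exp (Complex.I * (θ (x, 0) : ℂ))‖ ^ 2 / (L : ℝ) ^ 4; Z ≠ 0 ∧ (1/2 : ℝ) ≤ ((MeasureTheory.integral (MeasureTheory.volume.restrict cube) (fun θ => (O θ : ℂ) * Complex.exp (-(A θ)))) / Z).re

/-- Strict positivity of `c₀` is load-bearing: at `c₀ = 0` coercivity reads `0 ≤ Re F`, the zero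
table is admissible and the slice order is `1/L² < 1/2`. -/
theorem birComplexStableXY_false_with_c₀_nonneg : ¬ BirComplexStableXYWithC₀Nonneg := by
  intro h
  obtain ⟨K₀, L₀, h⟩ := h 2 0 0 le_rfl le_rfl
  set L : ℕ := max L₀ 2 with hLdef
  haveI : NeZero L := ⟨by omega⟩
  have hL : L₀ ≤ L := le_max_left _ _
  have h2 : 2 ≤ L := le_max_right _ _
  obtain ⟨_, hO⟩ := h K₀ le_rfl 0 (by simp) (by simp) (by simp) (by intro φ; simp) L L hL le_rfl
  simp only [Finsupp.sum_zero_index, Finset.sum_const_zero, mul_zero, neg_zero, Complex.exp_zero,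
    mul_one] at hO
  exact absurd hO (not_le.mpr (sliceOrder_zero_action_re h2))

/-- The engine `BirComplexStableXY` with the window lower bound `2 ≤ r` DELETED (all other text
verbatim). -/
def BirComplexStableXYAnyWindow : Prop :=
  ∀ (r : ℕ) (B c₀ : ℝ), 0 < c₀ → ∃ K₀ : ℝ, ∃ L₀ : ℕ, ∀ K : ℝ, K₀ ≤ K → ∀ c : ((Fin r × Fin r × Fin r) → ℤ) →₀ ℂ, (∀ n ∈ c.support, ∑ w, n w = 0) → c.sum (fun _ a => a) = 0 → c.sum (fun n a => ‖a‖ * Real.exp (∑ w, |(n w : ℝ)|)) ≤ B → (∀ φ : (Fin r × Fin r × Fin r) → ℝ, c₀ * ∑ w, ∑ w', (1 - Real.cos (φ w - φ w')) ≤ ((fun (φ : (Fin r × Fin r × Fin r) → ℝ) => c.sum (fun n a => a * Complex.exp (Complex.I * ((∑ w, (n w : ℝ) * φ w : ℝ) : ℂ)))) φ).re) → ∀ (L M : ℕ) [NeZero L] [NeZero M], L₀ ≤ L → L ≤ M → let sh : (Literature.Probability.LatticeModels.TorusSite 2 L × ZMod M) → (Fin r × Fin r × Fin r) → (Literature.Probability.LatticeModels.TorusSite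 2 L × ZMod M) := fun s w => (s.1 + ![((w.1 : ℕ) : ZMod L), ((w.2.1 : ℕ) : ZMod L)], s.2 + ((w.2.2 : ℕ) : ZMod M)); let F : ((Fin r × Fin r × Fin r) → ℝ) → ℂ := fun (φ : (Fin r × Fin r × Fin r) → ℝ) => c.sum (fun n a => a * Complex.exp (Complex.I * ((∑ w, (n w : ℝ) * φ w : ℝ) : ℂ))); let A : ((Literature.Probability.LatticeModels.TorusSite 2 L × ZMod M) → ℝ) → ℂ := fun θ => (K : ℂ) * ∑ s : (Literature.Probability.LatticeModels.TorusSite 2 L × ZMod M), F (fun w => θ (sh s w)); let cube : Set ((Literature.Probability.LatticeModels.TorusSite 2 L × ZMod M) → ℝ) := Set.pi Set.univ (fun _ => Set.Icc (0:ℝ) (2 * Real.pi)); let Z : ℂ := MeasureTheory.integral (MeasureTheory.volume.restrict cube) (fun θ => Complex.exp (-(A θ))); let O : ((Literature.Probability.LatticeModels.TorusSite 2 L × ZMod M) → ℝ) → ℝ := fun θ => ‖∑ x : Literature.Probability.LatticeModels.TorusSite 2 L, Complex.exp (Complex.I * (θ (x, 0) : ℂ))‖ ^ 2 / (L : ℝ)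 ^ 4; Z ≠ 0 ∧ (1/2 : ℝ) ≤ ((MeasureTheory.integral (MeasureTheory.volume.restrict cube) (fun θ => (O θ : ℂ) * Complex.exp (-(A θ)))) / Z).re

/-- `2 ≤ r` is load-bearing: on the one-point window `r = 1` the coercivity form
`Σ_{w,w'} (1 − cos(φ_w − φ_{w'}))` vanishes identically, so the zero table is admissible even with
`c₀ = 1`, and the slice order is `1/L² < 1/2`. -/
theorem birComplexStableXY_false_without_window_lb : ¬ BirComplexStableXYAnyWindow := by
  intro h
  obtain ⟨K₀, L₀, h⟩ := h 1 0 1 one_pos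
  set L : ℕ := max L₀ 2 with hLdef
  haveI : NeZero L := ⟨by omega⟩
  have hL : L₀ ≤ L := le_max_left _ _
  have h2 : 2 ≤ L := le_max_right _ _
  have hC : ∀ φ : (Fin 1 × Fin 1 × Fin 1) → ℝ, (1:ℝ) * ∑ w, ∑ w', (1 - Real.cos (φ w - φ w')) ≤
      ((fun (φ : (Fin 1 × Fin 1 × Fin 1) → ℝ) => (0 : ((Fin 1 × Fin 1 × Fin 1) → ℤ) →₀ ℂ).sum
        (fun n a => a * Complex.exp (Complex.I * ((∑ w, (n w : ℝ) * φ w : ℝ) : ℂ)))) φ).re := by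
    intro φ
    have hw : ∀ w w' : Fin 1 × Fin 1 × Fin 1, w = w' := fun w w' => Subsingleton.elim w w'
    simp [hw _ (default : Fin 1 × Fin 1 × Fin 1)]
  obtain ⟨_, hO⟩ := h K₀ le_rfl 0 (by simp) (by simp) (by simp) hC L L hL le_rfl
  simp only [Finsupp.sum_zero_index, Finset.sum_const_zero, mul_zero, neg_zero, Complex.exp_zero,
    mul_one] at hO
  exact absurd hO (not_le.mpr (sliceOrder_zero_action_re h2))

/-! ## §3b Tightness of the target's normalisation (caps the reduction's output constant) -/

section Tightness

open Matrix Literature.MathematicalPhysics.QuantumLattice Literature.Probability.LatticeModels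
open scoped Matrix.Norms.L2Operator ComplexOrder


/-- `|g_d(e)| ≤ 1` for the `d_{x²-y²}` form factor (its values are `0, ±1`). -/
theorem abs_dWaveFormFactor_le_one (e : Site 2) : |dWaveFormFactor e| ≤ 1 := by
  unfold dWaveFormFactor
  split_ifs <;> simp

/-- Each summand of `localPair g L x` has operator norm `≤ 2|g e|/√2 ≤ 2` for `|g e| ≤ 1`. -/
theorem norm_localPair_dWave_le (L : ℕ) [NeZero L] (x : TorusSite 2 L) :
    ‖localPair dWaveFormFactor L x‖ ≤ 10 := by
  unfold localPair
  refine (norm_sum_le _ _).trans ?_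
  have hterm : ∀ e ∈ insert (0 : Site 2) unitSteps,
      ‖((dWaveFormFactor e / Real.sqrt 2 : ℝ) : ℂ) •
        (annihilation (orb (FermionTorus.ofTorusSite x) 0) *
            annihilation (orb (FermionTorus.ofTorusSite (x + Torus.proj L e)) 1) -
          annihilation (orb (FermionTorus.ofTorusSite x) 1) *
            annihilation (orb (FermionTorus.ofTorusSite (x + Torus.proj L e)) 0) :
        Matrix (Finset (Orb (FermionTorus 2 L))) (Finset (Orb (FermionTorus 2 L))) ℂ)‖ ≤ 2 := by
    intro e _
    have hcoef : ‖((dWaveFormFactor e / Real.sqrt 2 : ℝ) : ℂ)‖ ≤ 1 := by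
      rw [Complex.norm_real, Real.norm_eq_abs, abs_div, abs_of_pos (Real.sqrt_pos.mpr two_pos)]
      have h2 : (1 : ℝ) ≤ Real.sqrt 2 := by
        rw [← Real.sqrt_one]; exact Real.sqrt_le_sqrt (by norm_num)
      calc |dWaveFormFactor e| / Real.sqrt 2 ≤ |dWaveFormFactor e| / 1 :=
            div_le_div_of_nonneg_left (abs_nonneg _) one_pos h2
        _ ≤ 1 := by rw [div_one]; exact abs_dWaveFormFactor_le_one e
    have hA : ∀ i : Orb (FermionTorus 2 L),
        ‖(annihilation i : Matrix (Finset (Orb (FermionTorus 2 L))) (Finset (Orb (FermionTorus 2 L))) ℂ)‖ ≤ 1 :=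
      fun i => norm_annihilation_le_one i
    refine (norm_smul_le _ _).trans ?_
    refine (mul_le_mul hcoef ((norm_sub_le _ _).trans (add_le_add (norm_mul_le _ _) (norm_mul_le _ _)))
      (norm_nonneg _) zero_le_one).trans ?_
    have := hA (orb (FermionTorus.ofTorusSite x) 0)
    have := hA (orb (FermionTorus.ofTorusSite (x + Torus.proj L e)) 1)
    have := hA (orb (FermionTorus.ofTorusSite x) 1)
    have := hA (orb (FermionTorus.ofTorusSite (x + Torus.proj L e)) 0)
    nlinarith [norm_nonneg (annihilation (orb (FermionTorus.ofTorusSite x) 0) : Matrix (Finset (Orb (FermionTorus 2 L))) (Finset (Orb (FermionTorus 2 L))) ℂ),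
      norm_nonneg (annihilation (orb (FermionTorus.ofTorusSite x) 1) : Matrix (Finset (Orb (FermionTorus 2 L))) (Finset (Orb (FermionTorus 2 L))) ℂ),
      norm_nonneg (annihilation (orb (FermionTorus.ofTorusSite (x + Torus.proj L e)) 0) : Matrix (Finset (Orb (FermionTorus 2 L))) (Finset (Orb (FermionTorus 2 L))) ℂ),
      norm_nonneg (annihilation (orb (FermionTorus.ofTorusSite (x + Torus.proj L e)) 1) : Matrix (Finset (Orb (FermionTorus 2 L))) (Finset (Orb (FermionTorus 2 L))) ℂ)]
  refine (Finset.sum_le_sum hterm).trans ?_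
  rw [Finset.sum_const, nsmul_eq_mul]
  have hcard : ((insert (0 : Site 2) unitSteps).card : ℝ) ≤ 5 := by
    have h4 : (unitSteps).card ≤ 4 := by unfold unitSteps; exact Finset.card_le_four
    have := Finset.card_insert_le (0 : Site 2) unitSteps
    exact_mod_cast this.trans (by omega)
  linarith

/-- `‖Δ_d‖ ≤ 10 L²` (triangle inequality over the `L²` sites). -/
theorem norm_pairField_dWave_le (L : ℕ) [NeZero L] :
    ‖pairField dWaveFormFactor L‖ ≤ 10 * (L : ℝ) ^ 2 := by
  unfold pairField
  refine (norm_sum_le _ _).trans ?_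
  refine (Finset.sum_le_sum fun x _ => norm_localPair_dWave_le L x).trans ?_
  rw [Finset.sum_const, nsmul_eq_mul, Finset.card_univ]
  have hcard : (Fintype.card (TorusSite 2 L) : ℝ) = (L : ℝ) ^ 2 := by
    rw [Fintype.card_pi, Finset.prod_const, ZMod.card, Finset.card_univ, Fintype.card_fin]
    push_cast; ring
  rw [hcard]; linarith [sq_nonneg (L : ℝ)]

/-- TIGHTNESS OF THE TARGET'S NORMALISATION. At any side `L ≥ 1`, hopping `t`, coupling `U`,
`δ ≥ -1`: if the trace bound `c·L⁴·Re tr P ≤ Re tr (P Δ_d†Δ_d)` of `BirGroundStateAverageLRO`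
holds at `(U, L)` then `c ≤ 100` — the exponent `4` is saturated (`‖Δ_d†Δ_d‖ ≤ 100 L⁴` and
`Re tr P ≥ 1`). -/
theorem constant_le_of_trace_bound (L : ℕ) [NeZero L] (t U δ c : ℝ) (hδ : -1 ≤ δ) :
    let N : ℕ := 2 * ⌊(1 - δ) * (L : ℝ) ^ 2 / 2⌋₊
    let H := hubbardTorus 2 L t U
    let S := szSector (Λ := FermionTorus 2 L) N 0
    let E₀ := S ⊓ Module.End.eigenspace (Matrix.toLin' H) ((H.minEnergyOn S : ℝ) : ℂ)
    let P := projMatrix (E₀.map (Fock.toEuclidean (ι := Orb (FermionTorus 2 L)) :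
      Fock (Orb (FermionTorus 2 L)) →ₗ[ℂ] EuclideanSpace ℂ (Finset (Orb (FermionTorus 2 L)))))
    c * (L : ℝ) ^ 4 * P.trace.re ≤
        (P * ((pairField dWaveFormFactor L)ᴴ * pairField dWaveFormFactor L)).trace.re →
      c ≤ 100 := by
  intro N H S E₀ P hP
  have h1 : 1 ≤ P.trace.re :=
    Summit.HubbardSuperconductivity.HubbardSuperconductivity.Theorems.one_le_re_trace_groundProj_hubbardTorus
      L t U δ hδ
  have hPSD : P.PosSemidef := by
    have h := Matrix.posSemidef_conjTranspose_mul_self P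
    rwa [(projMatrix_isHermitian _).eq, projMatrix_mul_self] at h
  set Δ := pairField dWaveFormFactor L with hΔ
  have h2 : (P * (Δᴴ * Δ)).trace.re ≤ ‖Δ‖ ^ 2 * P.trace.re := by
    calc (P * (Δᴴ * Δ)).trace.re ≤ ‖(P * (Δᴴ * Δ)).trace‖ := Complex.re_le_norm _
      _ = ‖((Δᴴ * Δ) * P).trace‖ := by rw [Matrix.trace_mul_comm]
      _ ≤ ‖Δᴴ * Δ‖ * P.trace.re := norm_trace_mul_le_opNorm_mul_re_trace _ hPSD
      _ = ‖Δ‖ ^ 2 * P.trace.re := by rw [Matrix.l2_opNorm_conjTranspose_mul_self, sq]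
  have h3 : ‖Δ‖ ≤ 10 * (L : ℝ) ^ 2 := norm_pairField_dWave_le L
  have h4 : ‖Δ‖ ^ 2 ≤ 100 * (L : ℝ) ^ 4 := by
    nlinarith [norm_nonneg Δ, sq_nonneg ((L : ℝ) ^ 2)]
  have hpos : 0 < (L : ℝ) ^ 4 * P.trace.re := by
    have : (0 : ℝ) < (L : ℝ) := by exact_mod_cast Nat.pos_of_ne_zero (NeZero.ne L)
    positivity
  have h5 : c * ((L : ℝ) ^ 4 * P.trace.re) ≤ 100 * ((L : ℝ) ^ 4 * P.trace.re) := by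
    calc c * ((L : ℝ) ^ 4 * P.trace.re) = c * (L : ℝ) ^ 4 * P.trace.re := by ring
      _ ≤ (P * (Δᴴ * Δ)).trace.re := hP
      _ ≤ ‖Δ‖ ^ 2 * P.trace.re := h2
      _ ≤ 100 * (L : ℝ) ^ 4 * P.trace.re := by gcongr
      _ = 100 * ((L : ℝ) ^ 4 * P.trace.re) := by ring
  exact le_of_mul_le_mul_right h5 hpos


/-- The natural strengthening of the target `BirGroundStateAverageLRO` with a constant `c > 100`
(all other text verbatim, `0 < c` replaced by `100 < c`) is FALSE: pick the midpoint of the window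
and one large even side and apply `constant_le_of_trace_bound`. -/
theorem not_target_with_constant_gt_100 :
    ¬ (∃ δ ∈ Set.Ioo (0:ℝ) (1/2), ∃ U₁ U₂ c : ℝ, 0 < U₁ ∧ U₁ < U₂ ∧ 100 < c ∧
      ∀ U ∈ Set.Ioo U₁ U₂, ∃ L₀ : ℕ, ∀ (L : ℕ) [NeZero L], L₀ ≤ L → Even L →
        let N : ℕ := 2 * ⌊(1 - δ) * (L : ℝ) ^ 2 / 2⌋₊
        let H := hubbardTorus 2 L 1 U
        let S := szSector (Λ := FermionTorus 2 L) N 0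
        let E₀ := S ⊓ Module.End.eigenspace (Matrix.toLin' H) ((H.minEnergyOn S : ℝ) : ℂ)
        let P := projMatrix (E₀.map (Fock.toEuclidean (ι := Orb (FermionTorus 2 L)) :
          Fock (Orb (FermionTorus 2 L)) →ₗ[ℂ] EuclideanSpace ℂ (Finset (Orb (FermionTorus 2 L)))))
        c * (L : ℝ) ^ 4 * P.trace.re ≤
          (P * ((pairField dWaveFormFactor L)ᴴ * pairField dWaveFormFactor L)).trace.re) := by
  rintro ⟨δ, hδ, U₁, U₂, c, hU₁, hU₁₂, hc, h⟩
  obtain ⟨L₀, hL₀⟩ := h ((U₁ + U₂) / 2) ⟨by linarith, by linarith⟩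
  haveI : NeZero (2 * (L₀ + 1)) := ⟨by omega⟩
  have hle : c ≤ 100 :=
    constant_le_of_trace_bound (2 * (L₀ + 1)) 1 ((U₁ + U₂) / 2) δ c (by linarith [hδ.1])
      (hL₀ (2 * (L₀ + 1)) (by omega) ⟨L₀ + 1, by ring⟩)
  linarith

end Tightness

/-! ## §3c The admissible class of the engine is inhabited: the real XY window table -/

section ClassInhabited

variable (r : ℕ)



/-- The window. -/
abbrev W : Type := Fin r × Fin r × Fin r

/-- The real XY window table: `F(φ) = c₀ Σ_{w,w'} (1 − e^{i(φ_w − φ_{w'})})`, i.e.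
`c = Σ_{(w,w')} c₀ • (δ_0 − δ_{e_w − e_{w'}})` (diagonal pairs contribute nothing). -/
noncomputable def xyTable (c₀ : ℝ) : (W r → ℤ) →₀ ℂ :=
  ∑ p : W r × W r, (c₀ : ℂ) • (Finsupp.single 0 1 - Finsupp.single (Pi.single p.1 1 - Pi.single p.2 1) 1)

variable {r}

/-- Linear functionals of the table. -/
theorem xyTable_sum_mul (c₀ : ℝ) (g : (W r → ℤ) → ℂ) :
    (xyTable r c₀).sum (fun n a => a * g n) =
      ∑ p : W r × W r, (c₀ : ℂ) * (g 0 - g (Pi.single p.1 1 - Pi.single p.2 1)) := by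
  unfold xyTable
  rw [← Finsupp.sum_finsetSum_index (by simp) (by intros; ring)]
  refine Finset.sum_congr rfl fun p _ => ?_
  rw [Finsupp.sum_smul_index' (by simp),
    Finsupp.sum_sub_index (by intros; simp only [smul_eq_mul]; ring),
    Finsupp.sum_single_index (by simp), Finsupp.sum_single_index (by simp)]
  simp only [smul_eq_mul]; ring

/-- Pointwise values of the table. -/
theorem xyTable_apply (c₀ : ℝ) (n : W r → ℤ) :
    xyTable r c₀ n = ∑ p : W r × W r, (c₀ : ℂ) * ((if n = 0 then 1 else 0) -
      (if n = Pi.single p.1 1 - Pi.single p.2 1 then 1 else 0)) := by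
  unfold xyTable
  rw [Finsupp.finsetSum_apply]
  refine Finset.sum_congr rfl fun p _ => ?_
  simp only [Finsupp.smul_apply, Finsupp.sub_apply, Finsupp.single_apply, smul_eq_mul]
  congr 2 <;> simp [eq_comm]

theorem sum_single_sub_single (w w' : W r) :
    ∑ v, (Pi.single w 1 - Pi.single w' 1 : W r → ℤ) v = 0 := by
  simp [Finset.sum_sub_distrib, Finset.sum_pi_single']

theorem sum_cast_single_mul (u : W r) (φ : W r → ℝ) :
    ∑ v, (((Pi.single u (1:ℤ) : W r → ℤ) v : ℤ) : ℝ) * φ v = φ u := by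
  rw [Finset.sum_eq_single u]
  · simp
  · intro v _ hv; simp [hv]
  · simp

theorem sum_cast_single_sub_mul (w w' : W r) (φ : W r → ℝ) :
    ∑ v, (((Pi.single w 1 - Pi.single w' 1 : W r → ℤ) v : ℤ) : ℝ) * φ v = φ w - φ w' := by
  simp only [Pi.sub_apply, Int.cast_sub, sub_mul, Finset.sum_sub_distrib, sum_cast_single_mul]

/-- (U1): every frequency in the support has zero total charge. -/
theorem xyTable_U1 (c₀ : ℝ) : ∀ n ∈ (xyTable r c₀).support, ∑ w, n w = 0 := by
  intro n hn
  by_contra hne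
  rw [Finsupp.mem_support_iff] at hn
  apply hn
  rw [xyTable_apply]
  refine Finset.sum_eq_zero fun p _ => ?_
  have h0 : n ≠ 0 := by rintro rfl; simp at hne
  have h1 : n ≠ Pi.single p.1 1 - Pi.single p.2 1 := by
    rintro rfl; exact hne (sum_single_sub_single p.1 p.2)
  simp [h0, h1]

/-- (N): the coefficients sum to zero. -/
theorem xyTable_N (c₀ : ℝ) : (xyTable r c₀).sum (fun _ a => a) = 0 := by
  have h := xyTable_sum_mul (r := r) c₀ (fun _ => (1 : ℂ))
  simp only [mul_one, sub_self, mul_zero, Finset.sum_const_zero] at h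
  exact h

/-- The generating function of the table. -/
theorem xyTable_F (c₀ : ℝ) (φ : W r → ℝ) :
    (xyTable r c₀).sum (fun n a => a * cexp (I * ((∑ w, (n w : ℝ) * φ w : ℝ) : ℂ))) =
      ∑ p : W r × W r, (c₀ : ℂ) * (1 - cexp (I * ((φ p.1 - φ p.2 : ℝ) : ℂ))) := by
  rw [xyTable_sum_mul]
  refine Finset.sum_congr rfl fun p _ => ?_
  simp only [sum_cast_single_sub_mul, Pi.zero_apply, Int.cast_zero, zero_mul,
    Finset.sum_const_zero, Complex.ofReal_zero, mul_zero, Complex.exp_zero]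

/-- (C): the real part of the generating function IS the coercivity form (equality). -/
theorem xyTable_C (c₀ : ℝ) (φ : W r → ℝ) :
    c₀ * ∑ w, ∑ w', (1 - Real.cos (φ w - φ w')) =
      ((xyTable r c₀).sum (fun n a => a * cexp (I * ((∑ w, (n w : ℝ) * φ w : ℝ) : ℂ)))).re := by
  have key : ∀ p : W r × W r, ((c₀ : ℂ) * (1 - cexp (I * ((φ p.1 - φ p.2 : ℝ) : ℂ)))).re
      = c₀ * (1 - Real.cos (φ p.1 - φ p.2)) := by
    intro p
    have h : cexp (I * ((φ p.1 - φ p.2 : ℝ) : ℂ)) =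
        (Real.cos (φ p.1 - φ p.2) : ℂ) + (Real.sin (φ p.1 - φ p.2) : ℂ) * I := by
      rw [mul_comm, Complex.exp_mul_I, Complex.ofReal_cos, Complex.ofReal_sin]
    rw [h]
    simp only [Complex.mul_re, Complex.sub_re, Complex.add_re, Complex.one_re, Complex.ofReal_re,
      Complex.ofReal_im, Complex.mul_im, Complex.I_re, Complex.I_im, Complex.sub_im, Complex.add_im,
      Complex.one_im]
    ring
  calc c₀ * ∑ w, ∑ w', (1 - Real.cos (φ w - φ w'))
        = ∑ w, ∑ w', c₀ * (1 - Real.cos (φ w - φ w')) := by simp only [Finset.mul_sum]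
    _ = ∑ p : W r × W r, c₀ * (1 - Real.cos (φ p.1 - φ p.2)) :=
        (Fintype.sum_prod_type' (fun w w' => c₀ * (1 - Real.cos (φ w - φ w')))).symm
    _ = _ := by
        rw [xyTable_F, Complex.re_sum]
        exact Finset.sum_congr rfl fun p _ => (key p).symm

theorem sum_abs_cast_single (u : W r) :
    ∑ v, |((((Pi.single u 1 : W r → ℤ)) v : ℤ) : ℝ)| = 1 := by
  rw [Finset.sum_eq_single u]
  · simp
  · intro v _ hv; simp [hv]
  · simp

theorem sum_abs_cast_single_sub_le (w w' : W r) :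
    ∑ v, |(((Pi.single w 1 - Pi.single w' 1 : W r → ℤ) v : ℤ) : ℝ)| ≤ 2 := by
  calc ∑ v, |(((Pi.single w 1 - Pi.single w' 1 : W r → ℤ) v : ℤ) : ℝ)|
        ≤ ∑ v, (|((((Pi.single w 1 : W r → ℤ)) v : ℤ) : ℝ)| + |((((Pi.single w' 1 : W r → ℤ)) v : ℤ) : ℝ)|) := by
          refine Finset.sum_le_sum fun v _ => ?_
          rw [Pi.sub_apply, Int.cast_sub]
          exact abs_sub _ _
    _ = 2 := by rw [Finset.sum_add_distrib, sum_abs_cast_single, sum_abs_cast_single]; norm_num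

/-- (A): the analytic (exponentially weighted ℓ¹) norm of the table is at most
`c₀ · r⁶ · (1 + e²)` (`r⁶ = |W_r × W_r|`). -/
theorem xyTable_A (c₀ : ℝ) (hc₀ : 0 ≤ c₀) :
    (xyTable r c₀).sum (fun n a => ‖a‖ * Real.exp (∑ w, |(n w : ℝ)|)) ≤
      c₀ * Fintype.card (W r × W r) * (1 + Real.exp 2) := by
  set S := (xyTable r c₀).support with hS
  set d : W r × W r → (W r → ℤ) := fun p => Pi.single p.1 1 - Pi.single p.2 1 with hd
  set f : W r × W r → (W r → ℤ) → ℝ := fun p n =>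
    ‖((if n = 0 then (1:ℂ) else 0) - (if n = d p then 1 else 0))‖ * Real.exp (∑ w, |(n w : ℝ)|) with hf
  have hf0 : ∀ p n, 0 ≤ f p n := fun p n => by positivity
  -- pointwise bound on the coefficients
  have hcoef : ∀ n, ‖xyTable r c₀ n‖ * Real.exp (∑ w, |(n w : ℝ)|) ≤ ∑ p, c₀ * f p n := by
    intro n
    rw [xyTable_apply]
    calc ‖∑ p : W r × W r, (c₀ : ℂ) * ((if n = 0 then 1 else 0) - (if n = Pi.single p.1 1 - Pi.single p.2 1 then 1 else 0))‖
            * Real.exp (∑ w, |(n w : ℝ)|)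
          ≤ (∑ p : W r × W r, ‖(c₀ : ℂ) * ((if n = 0 then 1 else 0) - (if n = Pi.single p.1 1 - Pi.single p.2 1 then 1 else 0))‖)
            * Real.exp (∑ w, |(n w : ℝ)|) :=
            mul_le_mul_of_nonneg_right (norm_sum_le _ _) (Real.exp_nonneg _)
      _ = ∑ p, c₀ * f p n := by
            rw [Finset.sum_mul]
            refine Finset.sum_congr rfl fun p _ => ?_
            rw [norm_mul, Complex.norm_real, Real.norm_of_nonneg hc₀, hf, hd, mul_assoc]
  -- per-pair bound
  have hpair : ∀ p, ∑ n ∈ S, f p n ≤ 1 + Real.exp 2 := by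
    intro p
    by_cases hdp : d p = 0
    · have : ∀ n, f p n = 0 := fun n => by simp [hf, hdp]
      simp only [this, Finset.sum_const_zero]; positivity
    · have hzero : ∀ n ∈ S, n ∉ S ∩ {0, d p} → f p n = 0 := by
        intro n hn hn'
        have h1 : n ≠ 0 := fun h => hn' (Finset.mem_inter.mpr ⟨hn, by simp [h]⟩)
        have h2 : n ≠ d p := fun h => hn' (Finset.mem_inter.mpr ⟨hn, by simp [h]⟩)
        simp [hf, h1, h2]
      rw [← Finset.sum_subset Finset.inter_subset_left hzero]
      calc ∑ n ∈ S ∩ {0, d p}, f p n ≤ ∑ n ∈ ({0, d p} : Finset (W r → ℤ)), f p n :=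
            Finset.sum_le_sum_of_subset_of_nonneg Finset.inter_subset_right (fun n _ _ => hf0 p n)
        _ = f p 0 + f p (d p) := Finset.sum_pair (Ne.symm hdp)
        _ ≤ 1 + Real.exp 2 := by
            have e0 : f p 0 = 1 := by simp [hf, Ne.symm hdp]
            have e1 : f p (d p) ≤ Real.exp 2 := by
              have : f p (d p) = Real.exp (∑ w, |((d p w : ℤ) : ℝ)|) := by simp [hf, hdp]
              rw [this]
              exact Real.exp_le_exp.mpr (sum_abs_cast_single_sub_le p.1 p.2)
            linarith
  -- assemble
  calc (xyTable r c₀).sum (fun n a => ‖a‖ * Real.exp (∑ w, |(n w : ℝ)|))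
        = ∑ n ∈ S, ‖xyTable r c₀ n‖ * Real.exp (∑ w, |(n w : ℝ)|) := rfl
    _ ≤ ∑ n ∈ S, ∑ p, c₀ * f p n := Finset.sum_le_sum fun n _ => hcoef n
    _ = ∑ p, ∑ n ∈ S, c₀ * f p n := Finset.sum_comm
    _ ≤ ∑ _p : W r × W r, c₀ * (1 + Real.exp 2) := by
        refine Finset.sum_le_sum fun p _ => ?_
        rw [← Finset.mul_sum]
        exact mul_le_mul_of_nonneg_left (hpair p) hc₀
    _ = c₀ * Fintype.card (W r × W r) * (1 + Real.exp 2) := by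
        rw [Finset.sum_const, Finset.card_univ, nsmul_eq_mul]; ring

/-- THE ADMISSIBLE CLASS OF THE ENGINE IS INHABITED (for `B ≥ c₀ r⁶ (1 + e²)`): the real XY window
table satisfies (U1), (N), (A) and (C) — with EQUALITY in (C). -/
theorem engine_class_inhabited (r : ℕ) (c₀ : ℝ) (hc₀ : 0 ≤ c₀) :
    ∃ c : ((Fin r × Fin r × Fin r) → ℤ) →₀ ℂ,
      (∀ n ∈ c.support, ∑ w, n w = 0) ∧
      c.sum (fun _ a => a) = 0 ∧
      c.sum (fun n a => ‖a‖ * Real.exp (∑ w, |(n w : ℝ)|)) ≤ c₀ * (r : ℝ) ^ 6 * (1 + Real.exp 2) ∧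
      (∀ φ : (Fin r × Fin r × Fin r) → ℝ, c₀ * ∑ w, ∑ w', (1 - Real.cos (φ w - φ w')) ≤
        ((fun (φ : (Fin r × Fin r × Fin r) → ℝ) => c.sum (fun n a => a * Complex.exp (Complex.I *
          ((∑ w, (n w : ℝ) * φ w : ℝ) : ℂ)))) φ).re) := by
  refine ⟨xyTable r c₀, xyTable_U1 c₀, xyTable_N c₀, ?_, fun φ => le_of_eq (xyTable_C c₀ φ)⟩
  have hcard : (Fintype.card (W r × W r) : ℝ) = (r : ℝ) ^ 6 := by
    simp only [Fintype.card_prod, Fintype.card_fin]; push_cast; ring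
  have := xyTable_A (r := r) c₀ hc₀
  rw [hcard] at this
  exact this


/-- The hypotheses of `BirComplexStableXY` are SIMULTANEOUSLY SATISFIABLE at admissible parameters
(`r = 2`, `c₀ = 1`, `B = 64(1+e²)`): the engine is not a statement about the empty class. -/
theorem engine_hypotheses_satisfiable :
    ∃ (r : ℕ) (B c₀ : ℝ) (c : ((Fin r × Fin r × Fin r) → ℤ) →₀ ℂ), 2 ≤ r ∧ 0 < c₀ ∧
      (∀ n ∈ c.support, ∑ w, n w = 0) ∧
      c.sum (fun _ a => a) = 0 ∧
      c.sum (fun n a => ‖a‖ * Real.exp (∑ w, |(n w : ℝ)|)) ≤ B ∧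
      (∀ φ : (Fin r × Fin r × Fin r) → ℝ, c₀ * ∑ w, ∑ w', (1 - Real.cos (φ w - φ w')) ≤
        ((fun (φ : (Fin r × Fin r × Fin r) → ℝ) => c.sum (fun n a => a * Complex.exp (Complex.I *
          ((∑ w, (n w : ℝ) * φ w : ℝ) : ℂ)))) φ).re) := by
  obtain ⟨c, h1, h2, h3, h4⟩ := engine_class_inhabited 2 1 zero_le_one
  exact ⟨2, 1 * (2:ℝ) ^ 6 * (1 + Real.exp 2), 1, c, le_rfl, one_pos, h1, h2, h3, h4⟩

end ClassInhabited

/-! ## §4 Restated (time-reflective) engine and the sandwich -/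

/-- The engine restricted to TIME-REFLECTIVE tables: `F (φ ∘ R) = conj (F φ)` for every real `φ`,
`R (w₁, w₂, w₃) = (w₁, w₂, rev w₃)` the temporal reflection of the window; on Fourier tables this
reads `c (n ∘ R) = conj (c (-n))` (NOT `conj (c n)`: the time-odd, purely imaginary Berry term
`iε₂ sin(φ_(0,0,1) − φ_(0,0,0))` must and does pass, the time-even imaginary dressing
`iε₁ Σ(1 − cos)` of the stmt-2080 counterexample must and does fail). This is the reality /
reflection property `S(Rθ) = conj S(θ)` of any action obtained by integrating out fermions with a
self-adjoint Hamiltonian (transfer-matrix Hermiticity), i.e. the repair proposed on stmt-2080, in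
hypothesis form. All other text of `BirComplexStableXY` verbatim. -/
def BirComplexStableXYTimeReflective : Prop :=
  ∀ (r : ℕ) (B c₀ : ℝ), 2 ≤ r → 0 < c₀ → ∃ K₀ : ℝ, ∃ L₀ : ℕ, ∀ K : ℝ, K₀ ≤ K → ∀ c : ((Fin r × Fin r × Fin r) → ℤ) →₀ ℂ, (∀ n ∈ c.support, ∑ w, n w = 0) → c.sum (fun _ a => a) = 0 → c.sum (fun n a => ‖a‖ * Real.exp (∑ w, |(n w : ℝ)|)) ≤ B → (∀ φ : (Fin r × Fin r × Fin r) → ℝ, ((fun (φ : (Fin r × Fin r × Fin r) → ℝ) => c.sum (fun n a => a * Complex.exp (Complex.I * ((∑ w, (n w : ℝ) * φ w : ℝ) : ℂ)))) (fun w => φ (w.1, w.2.1, Fin.rev w.2.2))) = (starRingEnd ℂ) (((fun (φ : (Fin r × Fin r × Fin r) → ℝ) => c.sum (fun n a => a * Complex.exp (Complex.I * ((∑ w, (n w : ℝ) * φ w : ℝ) : ℂ)))) φ))) → (∀ φ : (Fin r × Fin r × Fin r) → ℝ, c₀ * ∑ w, ∑ w', (1 - Real.cos (φ w - φ w')) ≤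 ((fun (φ : (Fin r × Fin r × Fin r) → ℝ) => c.sum (fun n a => a * Complex.exp (Complex.I * ((∑ w, (n w : ℝ) * φ w : ℝ) : ℂ)))) φ).re) → ∀ (L M : ℕ) [NeZero L] [NeZero M], L₀ ≤ L → L ≤ M → let sh : (Literature.Probability.LatticeModels.TorusSite 2 L × ZMod M) → (Fin r × Fin r × Fin r) → (Literature.Probability.LatticeModels.TorusSite 2 L × ZMod M) := fun s w => (s.1 + ![((w.1 : ℕ) : ZMod L), ((w.2.1 : ℕ) : ZMod L)], s.2 + ((w.2.2 : ℕ) : ZMod M)); let F : ((Fin r × Fin r × Fin r) → ℝ) → ℂ := fun (φ : (Fin r × Fin r × Fin r) → ℝ) => c.sum (fun n a => a * Complex.exp (Complex.I * ((∑ w, (n w : ℝ) * φ w : ℝ) : ℂ))); let A : ((Literature.Probability.LatticeModels.TorusSite 2 L × ZMod M) → ℝ) → ℂ := fun θ => (K : ℂ) * ∑ s : (Literature.Probability.LatticeModels.TorusSite 2 L × ZMod M), F (fun w => θ (sh s w)); let cube : Set ((Literature.Probability.LatticeModels.TorusSite 2 L × ZMod M) → ℝ) := Set.pi Set.univ (fun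 _ => Set.Icc (0:ℝ) (2 * Real.pi)); let Z : ℂ := MeasureTheory.integral (MeasureTheory.volume.restrict cube) (fun θ => Complex.exp (-(A θ))); let O : ((Literature.Probability.LatticeModels.TorusSite 2 L × ZMod M) → ℝ) → ℝ := fun θ => ‖∑ x : Literature.Probability.LatticeModels.TorusSite 2 L, Complex.exp (Complex.I * (θ (x, 0) : ℂ))‖ ^ 2 / (L : ℝ) ^ 4; Z ≠ 0 ∧ (1/2 : ℝ) ≤ ((MeasureTheory.integral (MeasureTheory.volume.restrict cube) (fun θ => (O θ : ℂ) * Complex.exp (-(A θ)))) / Z).re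

/-- The typed engine implies its time-reflective restriction (larger class ⇒ smaller class). -/
theorem engine_imp_timeReflective : BirComplexStableXY → BirComplexStableXYTimeReflective := by
  intro h r B c₀ hr hc₀
  obtain ⟨K₀, L₀, h⟩ := h r B c₀ hr hc₀
  exact ⟨K₀, L₀, fun K hK c h1 h2 h3 _hR h4 L M _ _ hL hLM => h K hK c h1 h2 h3 h4 L M hL hLM⟩

/-- The honest (restated) reduction: time-reflective engine ⇒ target. -/
def BirGappedPhaseReductionTimeReflective : Prop :=
  BirComplexStableXYTimeReflective → BirGroundStateAverageLRO

/-- SANDWICH. A proof of the restated reduction proves stmt-2082 as typed. Together with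
`reduction_of_not_engine`: 2082 ⇐ (honest reduction) and 2082 ⇐ ¬engine. -/
theorem reduction_of_timeReflectiveReduction :
    BirGappedPhaseReductionTimeReflective → BirGappedPhaseReduction :=
  fun h e => h (engine_imp_timeReflective e)

/-! ## §4b The stmt-2080 counterexample table: admissible as typed, excluded by time-reflectivity -/

namespace TimeReflection


/-- Window of side 2 and its temporal reflection `R (w₁,w₂,w₃) = (w₁,w₂,rev w₃)`. -/
abbrev W2 : Type := Fin 2 × Fin 2 × Fin 2

def R (w : W2) : W2 := (w.1, w.2.1, Fin.rev w.2.2)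

/-- The two window points of the temporal bond: `a = (0,0,1)`, `b = (0,0,0)`. -/
def pa : W2 := (0, 0, 1)
def pb : W2 := (0, 0, 0)

@[simp] theorem R_pa : R pa = pb := by decide
@[simp] theorem R_pb : R pb = pa := by decide

/-- The generating function of a table, as in `BirComplexStableXY`. -/
noncomputable def F (c : (W2 → ℤ) →₀ ℂ) (φ : W2 → ℝ) : ℂ :=
  c.sum (fun n a => a * cexp (I * ((∑ w, (n w : ℝ) * φ w : ℝ) : ℂ)))

/-- Time-reflectivity of a table (the hypothesis added in `BirComplexStableXYTimeReflective`). -/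
def TimeReflective (c : (W2 → ℤ) →₀ ℂ) : Prop := ∀ φ : W2 → ℝ, F c (fun w => φ (R w)) = conj (F c φ)

/-- The Berry (time-odd, purely imaginary) table `iε₂ sin(φ_a − φ_b) = (ε₂/2)(e^{i(φ_a−φ_b)} − e^{−i(φ_a−φ_b)})`. -/
noncomputable def berryTable (ε₂ : ℝ) : (W2 → ℤ) →₀ ℂ :=
  ((ε₂ / 2 : ℝ) : ℂ) • (Finsupp.single (Pi.single pa 1 - Pi.single pb 1) 1 -
    Finsupp.single (-(Pi.single pa 1 - Pi.single pb 1)) 1)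

theorem sum_cast_single_mul (u : W2) (φ : W2 → ℝ) :
    ∑ v, (((Pi.single u 1 : W2 → ℤ) v : ℤ) : ℝ) * φ v = φ u := by
  rw [Finset.sum_eq_single u]
  · simp
  · intro v _ hv; simp [hv]
  · simp

theorem sum_cast_d_mul (φ : W2 → ℝ) :
    ∑ v, (((Pi.single pa 1 - Pi.single pb 1 : W2 → ℤ) v : ℤ) : ℝ) * φ v = φ pa - φ pb := by
  simp only [Pi.sub_apply, Int.cast_sub, sub_mul, Finset.sum_sub_distrib, sum_cast_single_mul]

theorem sum_cast_neg_d_mul (φ : W2 → ℝ) :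
    ∑ v, (((-(Pi.single pa 1 - Pi.single pb 1) : W2 → ℤ) v : ℤ) : ℝ) * φ v = -(φ pa - φ pb) := by
  rw [← sum_cast_d_mul φ, ← Finset.sum_neg_distrib]
  refine Finset.sum_congr rfl fun v _ => ?_
  rw [Pi.neg_apply, Int.cast_neg, neg_mul]

theorem F_berry (ε₂ : ℝ) (φ : W2 → ℝ) :
    F (berryTable ε₂) φ = ((ε₂ / 2 : ℝ) : ℂ) *
      (cexp (I * ((φ pa - φ pb : ℝ) : ℂ)) - cexp (I * ((-(φ pa - φ pb) : ℝ) : ℂ))) := by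
  unfold F berryTable
  rw [Finsupp.sum_smul_index' (by simp),
    Finsupp.sum_sub_index (by intros; simp only [smul_eq_mul]; ring),
    Finsupp.sum_single_index (by simp), Finsupp.sum_single_index (by simp),
    sum_cast_d_mul, sum_cast_neg_d_mul]
  simp only [smul_eq_mul]; ring

/-- THE BERRY TERM PASSES time-reflectivity (`c (n∘R) = conj (c (−n))` form). -/
theorem berry_timeReflective (ε₂ : ℝ) : TimeReflective (berryTable ε₂) := by
  intro φ
  rw [F_berry, F_berry, R_pa, R_pb, map_mul, Complex.conj_ofReal, map_sub, ← Complex.exp_conj,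
    ← Complex.exp_conj, map_mul, map_mul, Complex.conj_I, Complex.conj_ofReal, Complex.conj_ofReal]
  congr 1
  push_cast
  ring_nf

/-! ### The complex-coefficient XY window table `κ Σ_{w,w'} (1 − e^{i(φ_w − φ_{w'})})` -/

noncomputable def xyTableC (κ : ℂ) : (W2 → ℤ) →₀ ℂ :=
  ∑ p : W2 × W2, κ • (Finsupp.single 0 1 - Finsupp.single (Pi.single p.1 1 - Pi.single p.2 1) 1)

theorem xyTableC_sum_mul (κ : ℂ) (g : (W2 → ℤ) → ℂ) :
    (xyTableC κ).sum (fun n a => a * g n) =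
      ∑ p : W2 × W2, κ * (g 0 - g (Pi.single p.1 1 - Pi.single p.2 1)) := by
  unfold xyTableC
  rw [← Finsupp.sum_finsetSum_index (by simp) (by intros; ring)]
  refine Finset.sum_congr rfl fun p _ => ?_
  rw [Finsupp.sum_smul_index' (by simp),
    Finsupp.sum_sub_index (by intros; simp only [smul_eq_mul]; ring),
    Finsupp.sum_single_index (by simp), Finsupp.sum_single_index (by simp)]
  simp only [smul_eq_mul]; ring

theorem xyTableC_apply (κ : ℂ) (n : W2 → ℤ) :
    xyTableC κ n = ∑ p : W2 × W2, κ * ((if n = 0 then 1 else 0) -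
      (if n = Pi.single p.1 1 - Pi.single p.2 1 then 1 else 0)) := by
  unfold xyTableC
  rw [Finsupp.finsetSum_apply]
  refine Finset.sum_congr rfl fun p _ => ?_
  simp only [Finsupp.smul_apply, Finsupp.sub_apply, Finsupp.single_apply, smul_eq_mul]
  congr 2 <;> simp [eq_comm]

theorem sum_single_sub_single (w w' : W2) :
    ∑ v, (Pi.single w 1 - Pi.single w' 1 : W2 → ℤ) v = 0 := by
  simp [Finset.sum_sub_distrib, Finset.sum_pi_single']

theorem sum_cast_single_sub_mul (w w' : W2) (φ : W2 → ℝ) :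
    ∑ v, (((Pi.single w 1 - Pi.single w' 1 : W2 → ℤ) v : ℤ) : ℝ) * φ v = φ w - φ w' := by
  simp only [Pi.sub_apply, Int.cast_sub, sub_mul, Finset.sum_sub_distrib, sum_cast_single_mul]

theorem F_xyTableC (κ : ℂ) (φ : W2 → ℝ) :
    F (xyTableC κ) φ = ∑ p : W2 × W2, κ * (1 - cexp (I * ((φ p.1 - φ p.2 : ℝ) : ℂ))) := by
  unfold F
  rw [xyTableC_sum_mul]
  refine Finset.sum_congr rfl fun p _ => ?_
  simp only [sum_cast_single_sub_mul, Pi.zero_apply, Int.cast_zero, zero_mul,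
    Finset.sum_const_zero, Complex.ofReal_zero, mul_zero, Complex.exp_zero]

/-- An `R`-invariant test configuration: `0` on the half-window `w₁ = 0`, `π` on `w₁ = 1`. -/
noncomputable def φ₀ : W2 → ℝ := fun w => if w.1 = 0 then 0 else Real.pi

theorem φ₀_R (w : W2) : φ₀ (R w) = φ₀ w := rfl

theorem cexp_I_pi : cexp (I * (Real.pi : ℂ)) = -1 := by
  rw [mul_comm]; exact Complex.exp_pi_mul_I

theorem cexp_neg_I_pi : cexp (-(I * (Real.pi : ℂ))) = -1 := by
  rw [Complex.exp_neg, cexp_I_pi]; norm_num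

theorem exp_phase_φ₀ (p : W2 × W2) :
    cexp (I * ((φ₀ p.1 - φ₀ p.2 : ℝ) : ℂ)) = if p.1.1 = p.2.1 then 1 else -1 := by
  obtain ⟨⟨i, x⟩, ⟨j, y⟩⟩ := p
  fin_cases i <;> fin_cases j <;> simp [φ₀, cexp_I_pi, cexp_neg_I_pi]

theorem F_xyTableC_φ₀ (κ : ℂ) : F (xyTableC κ) φ₀ = 64 * κ := by
  rw [F_xyTableC]
  simp only [exp_phase_φ₀]
  rw [Fintype.sum_prod_type]
  simp only [Fintype.sum_prod_type, Fin.sum_univ_two, Fin.isValue]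
  norm_num
  ring

/-- THE TIME-EVEN IMAGINARY DRESSING FAILS time-reflectivity: the complex-coefficient XY window
table is time-reflective only if `Im κ = 0` (test configuration `φ₀`, which is `R`-invariant and
has `F(φ₀) = 64κ`). In particular the stmt-2080 counterexample coefficient `κ = c₀ + iε₁`,
`ε₁ ≠ 0`, is excluded by the restated class. -/
theorem xyTableC_not_timeReflective (κ : ℂ) (hκ : κ.im ≠ 0) : ¬ TimeReflective (xyTableC κ) := by
  intro h
  have h1 := h φ₀
  have h2 : (fun w => φ₀ (R w)) = φ₀ := funext φ₀_R
  rw [h2, F_xyTableC_φ₀, map_mul] at h1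
  have h3 : conj κ = κ := by
    have h64 : conj (64 : ℂ) = 64 := by norm_num [map_ofNat]
    rw [h64] at h1
    have := mul_left_cancel₀ (by norm_num : (64 : ℂ) ≠ 0) h1
    exact this.symm
  exact hκ (Complex.conj_eq_iff_im.mp h3)

/-! ### The stmt-2080 counterexample table is ADMISSIBLE in the typed class -/

/-- `T = (c₀ + iε₁)·XY-window + Berry(ε₂)`. -/
noncomputable def table2080 (c₀ ε₁ ε₂ : ℝ) : (W2 → ℤ) →₀ ℂ :=
  xyTableC ((c₀ : ℂ) + (ε₁ : ℂ) * I) + berryTable ε₂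

theorem berryTable_apply (ε₂ : ℝ) (n : W2 → ℤ) :
    berryTable ε₂ n = ((ε₂ / 2 : ℝ) : ℂ) *
      ((if n = (Pi.single pa 1 - Pi.single pb 1) then 1 else 0) -
       (if n = -(Pi.single pa 1 - Pi.single pb 1) then 1 else 0)) := by
  unfold berryTable
  simp only [Finsupp.smul_apply, Finsupp.sub_apply, Finsupp.single_apply, smul_eq_mul]
  congr 2 <;> simp [eq_comm]

/-- (U1) for `T`. -/
theorem table2080_U1 (c₀ ε₁ ε₂ : ℝ) : ∀ n ∈ (table2080 c₀ ε₁ ε₂).support, ∑ w, n w = 0 := by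
  intro n hn
  by_contra hne
  rw [Finsupp.mem_support_iff] at hn
  apply hn
  rw [table2080, Finsupp.add_apply, xyTableC_apply, berryTable_apply]
  have h0 : n ≠ 0 := by rintro rfl; simp at hne
  have hd : ∀ p : W2 × W2, n ≠ Pi.single p.1 1 - Pi.single p.2 1 := by
    rintro p rfl; exact hne (sum_single_sub_single p.1 p.2)
  have h1 : n ≠ Pi.single pa 1 - Pi.single pb 1 := hd (pa, pb)
  have h2 : n ≠ Pi.single pb 1 - Pi.single pa 1 := hd (pb, pa)
  simp [h0, hd, h1, h2]

/-- (N) for `T`. -/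
theorem table2080_N (c₀ ε₁ ε₂ : ℝ) : (table2080 c₀ ε₁ ε₂).sum (fun _ a => a) = 0 := by
  rw [table2080, Finsupp.sum_add_index' (by simp) (by simp)]
  have h1 := xyTableC_sum_mul ((c₀ : ℂ) + (ε₁ : ℂ) * I) (fun _ => (1 : ℂ))
  simp only [mul_one, sub_self, mul_zero, Finset.sum_const_zero] at h1
  have h2 : (berryTable ε₂).sum (fun _ a => a) = 0 := by
    unfold berryTable
    rw [Finsupp.sum_smul_index' (by simp),
      Finsupp.sum_sub_index (by intros; simp only [smul_eq_mul]; ring),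
      Finsupp.sum_single_index (by simp), Finsupp.sum_single_index (by simp)]
    simp
  rw [h1, h2, add_zero]

theorem F_add (c c' : (W2 → ℤ) →₀ ℂ) (φ : W2 → ℝ) : F (c + c') φ = F c φ + F c' φ := by
  unfold F
  exact Finsupp.sum_add_index' (by simp) (by intros; ring)

theorem re_F_berry (ε₂ : ℝ) (φ : W2 → ℝ) : (F (berryTable ε₂) φ).re = 0 := by
  rw [F_berry]
  have h : ∀ t : ℝ, cexp (I * (t : ℂ)) = (Real.cos t : ℂ) + (Real.sin t : ℂ) * I := fun t => by
    rw [mul_comm, Complex.exp_mul_I, Complex.ofReal_cos, Complex.ofReal_sin]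
  rw [h, h, Real.cos_neg, Real.sin_neg]
  simp only [Complex.mul_re, Complex.sub_re, Complex.add_re, Complex.ofReal_re, Complex.ofReal_im,
    Complex.mul_im, Complex.I_re, Complex.I_im, Complex.sub_im, Complex.add_im]
  ring

theorem sum_sin_antisymm (φ : W2 → ℝ) : ∑ p : W2 × W2, Real.sin (φ p.1 - φ p.2) = 0 := by
  set S := ∑ p : W2 × W2, Real.sin (φ p.1 - φ p.2) with hSdef
  have hS : S = -S := by
    calc S = ∑ x : W2, ∑ y : W2, Real.sin (φ x - φ y) := by
          rw [hSdef]; exact Fintype.sum_prod_type' (fun x y => Real.sin (φ x - φ y))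
      _ = ∑ y : W2, ∑ x : W2, Real.sin (φ x - φ y) := Finset.sum_comm
      _ = ∑ y : W2, ∑ x : W2, -Real.sin (φ y - φ x) := by
          refine Finset.sum_congr rfl fun y _ => Finset.sum_congr rfl fun x _ => ?_
          rw [← Real.sin_neg, neg_sub]
      _ = -S := by
          simp only [Finset.sum_neg_distrib]
          rw [hSdef]
          exact congrArg Neg.neg (Fintype.sum_prod_type' (fun y x => Real.sin (φ y - φ x))).symm
  linarith

theorem re_F_xyTableC (c₀ ε₁ : ℝ) (φ : W2 → ℝ) :
    (F (xyTableC ((c₀ : ℂ) + (ε₁ : ℂ) * I)) φ).re = c₀ * ∑ w, ∑ w', (1 - Real.cos (φ w - φ w')) := by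
  rw [F_xyTableC, Complex.re_sum]
  have key : ∀ p : W2 × W2, ((((c₀ : ℂ) + (ε₁ : ℂ) * I)) * (1 - cexp (I * ((φ p.1 - φ p.2 : ℝ) : ℂ)))).re
      = c₀ * (1 - Real.cos (φ p.1 - φ p.2)) + ε₁ * Real.sin (φ p.1 - φ p.2) := by
    intro p
    have h : cexp (I * ((φ p.1 - φ p.2 : ℝ) : ℂ)) =
        (Real.cos (φ p.1 - φ p.2) : ℂ) + (Real.sin (φ p.1 - φ p.2) : ℂ) * I := by
      rw [mul_comm, Complex.exp_mul_I, Complex.ofReal_cos, Complex.ofReal_sin]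
    rw [h]
    simp only [Complex.mul_re, Complex.sub_re, Complex.add_re, Complex.one_re, Complex.ofReal_re,
      Complex.ofReal_im, Complex.mul_im, Complex.I_re, Complex.I_im, Complex.sub_im, Complex.add_im,
      Complex.one_im]
    ring
  simp only [key, Finset.sum_add_distrib, ← Finset.mul_sum, sum_sin_antisymm, mul_zero, add_zero]
  congr 1
  exact Fintype.sum_prod_type' (fun w w' => 1 - Real.cos (φ w - φ w'))

/-- (C) for `T`, with EQUALITY: `Re F_T = c₀ Σ_{w,w'} (1 − cos(φ_w − φ_{w'}))`. -/
theorem table2080_C (c₀ ε₁ ε₂ : ℝ) (φ : W2 → ℝ) :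
    c₀ * ∑ w, ∑ w', (1 - Real.cos (φ w - φ w')) = (F (table2080 c₀ ε₁ ε₂) φ).re := by
  rw [table2080, F_add, Complex.add_re, re_F_berry, add_zero, re_F_xyTableC]

/-- `T` is NOT time-reflective when `ε₁ ≠ 0` (the Berry part is, the dressing is not). -/
theorem table2080_not_timeReflective (c₀ ε₁ ε₂ : ℝ) (hε₁ : ε₁ ≠ 0) :
    ¬ TimeReflective (table2080 c₀ ε₁ ε₂) := by
  intro h
  apply xyTableC_not_timeReflective ((c₀ : ℂ) + (ε₁ : ℂ) * I) (by simpa using hε₁)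
  intro φ
  have h1 := h φ
  have h2 := berry_timeReflective ε₂ φ
  rw [table2080, F_add, F_add, map_add, h2] at h1
  exact add_right_cancel h1

/-! ### (A) for `T`: an explicit analyticity budget -/

theorem sum_norm_weight_add_le (f g : (W2 → ℤ) →₀ ℂ) (e : (W2 → ℤ) → ℝ) (he : ∀ n, 0 ≤ e n) :
    (f + g).sum (fun n a => ‖a‖ * e n) ≤
      f.sum (fun n a => ‖a‖ * e n) + g.sum (fun n a => ‖a‖ * e n) := by
  rw [Finsupp.sum_of_support_subset (f + g) Finsupp.support_add _ (by simp),
    Finsupp.sum_of_support_subset f (Finset.subset_union_left (s₂ := g.support)) _ (by simp),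
    Finsupp.sum_of_support_subset g (Finset.subset_union_right (s₁ := f.support)) _ (by simp),
    ← Finset.sum_add_distrib]
  refine Finset.sum_le_sum fun n _ => ?_
  rw [Finsupp.add_apply, ← add_mul]
  exact mul_le_mul_of_nonneg_right (norm_add_le _ _) (he n)

theorem sum_abs_cast_single (u : W2) :
    ∑ v, |((((Pi.single u 1 : W2 → ℤ)) v : ℤ) : ℝ)| = 1 := by
  rw [Finset.sum_eq_single u]
  · simp
  · intro v _ hv; simp [hv]
  · simp

theorem sum_abs_cast_single_sub_le (w w' : W2) :
    ∑ v, |(((Pi.single w 1 - Pi.single w' 1 : W2 → ℤ) v : ℤ) : ℝ)| ≤ 2 := by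
  calc ∑ v, |(((Pi.single w 1 - Pi.single w' 1 : W2 → ℤ) v : ℤ) : ℝ)|
        ≤ ∑ v, (|((((Pi.single w 1 : W2 → ℤ)) v : ℤ) : ℝ)| + |((((Pi.single w' 1 : W2 → ℤ)) v : ℤ) : ℝ)|) := by
          refine Finset.sum_le_sum fun v _ => ?_
          rw [Pi.sub_apply, Int.cast_sub]
          exact abs_sub _ _
    _ = 2 := by rw [Finset.sum_add_distrib, sum_abs_cast_single, sum_abs_cast_single]; norm_num

theorem sum_abs_cast_neg_le (n : W2 → ℤ) :
    ∑ v, |(((-n) v : ℤ) : ℝ)| = ∑ v, |((n v : ℤ) : ℝ)| := by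
  refine Finset.sum_congr rfl fun v _ => ?_
  rw [Pi.neg_apply, Int.cast_neg, abs_neg]

theorem xyTableC_A (κ : ℂ) :
    (xyTableC κ).sum (fun n a => ‖a‖ * Real.exp (∑ w, |(n w : ℝ)|)) ≤ ‖κ‖ * 64 * (1 + Real.exp 2) := by
  set S := (xyTableC κ).support with hS
  set d : W2 × W2 → (W2 → ℤ) := fun p => Pi.single p.1 1 - Pi.single p.2 1 with hd
  set f : W2 × W2 → (W2 → ℤ) → ℝ := fun p n =>
    ‖((if n = 0 then (1:ℂ) else 0) - (if n = d p then 1 else 0))‖ * Real.exp (∑ w, |(n w : ℝ)|) with hf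
  have hf0 : ∀ p n, 0 ≤ f p n := fun p n => by positivity
  have hcoef : ∀ n, ‖xyTableC κ n‖ * Real.exp (∑ w, |(n w : ℝ)|) ≤ ∑ p, ‖κ‖ * f p n := by
    intro n
    rw [xyTableC_apply]
    calc ‖∑ p : W2 × W2, κ * ((if n = 0 then 1 else 0) - (if n = Pi.single p.1 1 - Pi.single p.2 1 then 1 else 0))‖
            * Real.exp (∑ w, |(n w : ℝ)|)
          ≤ (∑ p : W2 × W2, ‖κ * ((if n = 0 then 1 else 0) - (if n = Pi.single p.1 1 - Pi.single p.2 1 then 1 else 0))‖)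
            * Real.exp (∑ w, |(n w : ℝ)|) :=
            mul_le_mul_of_nonneg_right (norm_sum_le _ _) (Real.exp_nonneg _)
      _ = ∑ p, ‖κ‖ * f p n := by
            rw [Finset.sum_mul]
            refine Finset.sum_congr rfl fun p _ => ?_
            rw [norm_mul, hf, hd, mul_assoc]
  have hpair : ∀ p, ∑ n ∈ S, f p n ≤ 1 + Real.exp 2 := by
    intro p
    by_cases hdp : d p = 0
    · have : ∀ n, f p n = 0 := fun n => by simp [hf, hdp]
      simp only [this, Finset.sum_const_zero]; positivity
    · have hzero : ∀ n ∈ S, n ∉ S ∩ {0, d p} → f p n = 0 := by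
        intro n hn hn'
        have h1 : n ≠ 0 := fun h => hn' (Finset.mem_inter.mpr ⟨hn, by simp [h]⟩)
        have h2 : n ≠ d p := fun h => hn' (Finset.mem_inter.mpr ⟨hn, by simp [h]⟩)
        simp [hf, h1, h2]
      rw [← Finset.sum_subset Finset.inter_subset_left hzero]
      calc ∑ n ∈ S ∩ {0, d p}, f p n ≤ ∑ n ∈ ({0, d p} : Finset (W2 → ℤ)), f p n :=
            Finset.sum_le_sum_of_subset_of_nonneg Finset.inter_subset_right (fun n _ _ => hf0 p n)
        _ = f p 0 + f p (d p) := Finset.sum_pair (Ne.symm hdp)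
        _ ≤ 1 + Real.exp 2 := by
            have e0 : f p 0 = 1 := by simp [hf, Ne.symm hdp]
            have e1 : f p (d p) ≤ Real.exp 2 := by
              have : f p (d p) = Real.exp (∑ w, |((d p w : ℤ) : ℝ)|) := by simp [hf, hdp]
              rw [this]
              exact Real.exp_le_exp.mpr (sum_abs_cast_single_sub_le p.1 p.2)
            linarith
  calc (xyTableC κ).sum (fun n a => ‖a‖ * Real.exp (∑ w, |(n w : ℝ)|))
        = ∑ n ∈ S, ‖xyTableC κ n‖ * Real.exp (∑ w, |(n w : ℝ)|) := rfl
    _ ≤ ∑ n ∈ S, ∑ p, ‖κ‖ * f p n := Finset.sum_le_sum fun n _ => hcoef n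
    _ = ∑ p, ∑ n ∈ S, ‖κ‖ * f p n := Finset.sum_comm
    _ ≤ ∑ _p : W2 × W2, ‖κ‖ * (1 + Real.exp 2) := by
        refine Finset.sum_le_sum fun p _ => ?_
        rw [← Finset.mul_sum]
        exact mul_le_mul_of_nonneg_left (hpair p) (norm_nonneg κ)
    _ = ‖κ‖ * 64 * (1 + Real.exp 2) := by
        rw [Finset.sum_const, Finset.card_univ, nsmul_eq_mul]
        simp only [Fintype.card_prod, Fintype.card_fin]
        norm_num; ring

theorem berryTable_A (ε₂ : ℝ) :
    (berryTable ε₂).sum (fun n a => ‖a‖ * Real.exp (∑ w, |(n w : ℝ)|)) ≤ |ε₂| * Real.exp 2 := by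
  set S := (berryTable ε₂).support with hS
  set d : W2 → ℤ := Pi.single pa 1 - Pi.single pb 1 with hd
  have hdne : d ≠ -d := by
    intro h
    have := congrFun h pa
    simp [hd, pa, pb] at this
  set f : (W2 → ℤ) → ℝ := fun n => ‖berryTable ε₂ n‖ * Real.exp (∑ w, |(n w : ℝ)|) with hf
  have hf0 : ∀ n, 0 ≤ f n := fun n => by positivity
  have hzero : ∀ n ∈ S, n ∉ S ∩ {d, -d} → f n = 0 := by
    intro n hn hn'
    have h1 : n ≠ d := fun h => hn' (Finset.mem_inter.mpr ⟨hn, by simp [h]⟩)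
    have h2 : n ≠ -d := fun h => hn' (Finset.mem_inter.mpr ⟨hn, by simp [h]⟩)
    simp [hf, berryTable_apply, ← hd, h1, h2]
  have hval : ∀ n, f n ≤ |ε₂| / 2 * Real.exp (∑ w, |(n w : ℝ)|) := by
    intro n
    simp only [hf, berryTable_apply, ← hd, norm_mul, Complex.norm_real, Real.norm_eq_abs, abs_div,
      abs_two]
    refine mul_le_mul_of_nonneg_right ?_ (Real.exp_nonneg _)
    refine mul_le_of_le_one_right (by positivity) ?_
    split_ifs <;> simp
  have hsd : ∑ w, |((d w : ℤ) : ℝ)| ≤ 2 := sum_abs_cast_single_sub_le pa pb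
  have hsnd : ∑ w, |(((-d) w : ℤ) : ℝ)| ≤ 2 := by rw [sum_abs_cast_neg_le]; exact hsd
  calc (berryTable ε₂).sum (fun n a => ‖a‖ * Real.exp (∑ w, |(n w : ℝ)|)) = ∑ n ∈ S, f n := rfl
    _ = ∑ n ∈ S ∩ {d, -d}, f n := (Finset.sum_subset Finset.inter_subset_left hzero).symm
    _ ≤ ∑ n ∈ ({d, -d} : Finset (W2 → ℤ)), f n :=
        Finset.sum_le_sum_of_subset_of_nonneg Finset.inter_subset_right (fun n _ _ => hf0 n)
    _ = f d + f (-d) := Finset.sum_pair hdne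
    _ ≤ |ε₂| / 2 * Real.exp 2 + |ε₂| / 2 * Real.exp 2 := by
        gcongr
        · exact (hval d).trans (by gcongr)
        · exact (hval (-d)).trans (by gcongr)
    _ = |ε₂| * Real.exp 2 := by ring

/-- (A) for `T`: analyticity budget `B_T = ‖c₀ + iε₁‖·64·(1 + e²) + |ε₂| e²`. -/
theorem table2080_A (c₀ ε₁ ε₂ : ℝ) :
    (table2080 c₀ ε₁ ε₂).sum (fun n a => ‖a‖ * Real.exp (∑ w, |(n w : ℝ)|)) ≤
      ‖(c₀ : ℂ) + (ε₁ : ℂ) * I‖ * 64 * (1 + Real.exp 2) + |ε₂| * Real.exp 2 := by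
  rw [table2080]
  exact (sum_norm_weight_add_le _ _ _ (fun n => Real.exp_nonneg _)).trans
    (add_le_add (xyTableC_A _) (berryTable_A _))

/-- THE stmt-2080 COUNTEREXAMPLE TABLE IS ADMISSIBLE in the class of `BirComplexStableXY` at `r = 2`
(for every `B ≥ B_T`), with equality in (C) — and it is NOT time-reflective when `ε₁ ≠ 0`
(`table2080_not_timeReflective`), while its Berry part is (`berry_timeReflective`). -/
theorem table2080_admissible (c₀ ε₁ ε₂ : ℝ) :
    (∀ n ∈ (table2080 c₀ ε₁ ε₂).support, ∑ w, n w = 0) ∧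
    (table2080 c₀ ε₁ ε₂).sum (fun _ a => a) = 0 ∧
    (table2080 c₀ ε₁ ε₂).sum (fun n a => ‖a‖ * Real.exp (∑ w, |(n w : ℝ)|)) ≤
      ‖(c₀ : ℂ) + (ε₁ : ℂ) * I‖ * 64 * (1 + Real.exp 2) + |ε₂| * Real.exp 2 ∧
    (∀ φ : W2 → ℝ, c₀ * ∑ w, ∑ w', (1 - Real.cos (φ w - φ w')) ≤
      ((fun (φ : W2 → ℝ) => (table2080 c₀ ε₁ ε₂).sum (fun n a => a * Complex.exp (Complex.I *
          ((∑ w, (n w : ℝ) * φ w : ℝ) : ℂ)))) φ).re) :=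
  ⟨table2080_U1 c₀ ε₁ ε₂, table2080_N c₀ ε₁ ε₂, table2080_A c₀ ε₁ ε₂,
    fun φ => le_of_eq (table2080_C c₀ ε₁ ε₂ φ)⟩


end TimeReflection

end Summit.HubbardSuperconductivity.HubbardSuperconductivity.Cruxes.BirGappedPhaseReduction.Disproof
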